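import Literature.Computability.Complexity.PRelHierarchy
import Literature.Computability.Complexity.BranchingFn
import HarnessLib

/-!
# Cook reducibility is transitive, `P^{P^O} = P^O` — unconditionally (proof; trunk CplxCore)

Sibling proof file of `Oracle.lean` (D-0014), independent of the concurrently landed
`OracleComposition.lean`: that file builds the composite machine `OracleComposition.compose`
and proves the closure theorems *conditionally* on its named machine fact
`OracleAlg.isPolyTime_compose` (`mem_PRel_of_polyTimeTuringReducible_of`,
`polyTimeTuringReducible_trans_of`); here an independent construction `OracleCompose.compAlg`
is carried through to the end, machine included, so the discharges below are unconditional
(`_holds`). It discharges the named facts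

* `Literature.CplxCore.mem_PRel_of_polyTimeTuringReducible_holds : mem_PRel_of_polyTimeTuringReducible`
  — `L ≤ᵀₚ A`, `A ∈ P^O` ⇒ `L ∈ P^O` (`P^{P^O} = P^O`);
* `Literature.CplxCore.polyTimeTuringReducible_trans_holds : polyTimeTuringReducible_trans` —
  transitivity of Cook reducibility;
* `Literature.Computability.Complexity.PRelClass_PRelClass_subset_self` — `P^{P^C} ⊆ P^C` for every class `C`
  (Bremner–Jozsa–Shepherd 2011, §3.1, an ingredient of their Cor. 1),

in the transcript model of `Oracle.lean` (an oracle algorithm is a polynomial-time *step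
function* `(input, answers so far) ↦ next query or output`, run for polynomially many rounds).
Source: Ladner–Lynch–Selman, *A comparison of polynomial time reducibilities*, TCS 1 (1975), §2
("`≤ᵀᴾ` is transitive … the proof is routine": answer each query of the first procedure by
running the second). The routine proof becomes the following construction.

## The composite algorithm (mathematical level)

`OracleCompose.compAlg M₁ M₂ q₁ q₂`: its step function on `(x, ans)` replays the whole
simulation from the transcript `ans` of `O`-answers by iterating a *small step*
`OracleCompose.F` on states `(t1, rest, phase)` — `t1` the answer bits already fed to the outer
algorithm `M₁`, `rest` the not yet consumed `O`-answers, `phase ∈ {outer, inner y t2, done r}` —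
for `fuel = |ans| + 2 q₁|x| + 2` steps (`done` is a fixed point) and reports the result
(`OracleCompose.result`). Outer queries are truncated to `q₁|x|` symbols and inner queries to
`q₂(q₁|x|)` symbols; by the query-length clauses of `PRel` the truncations never act on a
genuine run, and they make the state grow linearly. Correctness (`compAlg_correct`): along the
genuine run (`RunData`, extracted from the two `PRel` hypotheses by `exists_runData` with the
unrolling lemmas `run_eq_some_iff`/`mem_queries_of_trans` of `PRelHierarchy.lean`) the
composite transcript is the concatenation of the inner transcripts (`trans_compAlg`), each query
position asks the corresponding inner query (`compAlg_step_query`) and the final position outputs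
the outer output (`compAlg_step_final`); the budget is `q₁ · (q₂ ∘ q₁) + q₂ ∘ q₁ + 1`.

## Polynomial time (`isPolyTime_compAlg`)

The state is kept as the string `⟨⟨x, ⟨1^{q₁|x|}, 1^{q₂(q₁|x|)}⟩⟩, ⟨t1, ⟨body rest, ph⟩⟩⟩`
(`encS`), and the small step is realised by a *total* `FP` string map `stepStr` assembled from
the tree's toolkit (pair projections, `copyFn`/`mapFstFn`/`mapSndFn` via `pairFn`,
`truncSndFn`, transducers) plus four transducers proved here: concatenation `concatT`
(re-proved: a twin of `EmptySim.concatT`/`concatT_eval` of the concurrently landed sibling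
`OracleEmpty.lean`, see the `refactor:` note below), the selector `selT` (giving the
`P`-guarded conditional `condFn`; constants come from `const_mem_FP` of `BranchingFn.lean`),
the middle-block extractor
`midT` (giving unary pads `padFn p = 1^{p|x|}` from the Horner clock `evalHdrFn`), and the
recogniser `codeT` of `listBool` transcript codes (`mem_codeLang_iff`), used to *sanitise* the
inner transcript before it is fed to the machine of `M₂` (`sanFn`, `decT`) — this is what makes
`stepStr` total and polynomial-time on *all* strings although the machine of `M₂` is only
specified on genuine codes. `stepStr_encS`: `stepStr (encS s) = encS (F s)`. The potential
argument `length_stepStr_le`/`length_iterate_stepStr_le` bounds `|stepStr^[n] v| ≤ 20(|v| + n)`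
for every string `v`, so `PolyTimeComputable.iterate` (`TM2Iterate.lean`, the clocked universal
machine) applies; the clock and the initial state are read off the input by `clockS`/`initS`
and combined by the transducer `optT`, and the result is read out by `readFn`.

refactor: `OracleCompose.concatT`/`concatT_eval_boolPair` and `EmptySim.concatT`/`concatT_eval`
(`OracleEmpty.lean`) are the same transducer with the same specification; a librarian should
hoist one copy (together with `unaryEncodeNat_eq_replicate`, `boolPair_ne_nil`) into a shared
toolkit file (`Transducers.lean`/`BoolEncodings.lean`, or next to `PrePost.selT` in
`OracleClosure.lean`) and point both files at it. With `mem_PRel_of_polyTimeTuringReducible_holds`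
the hypothesis `hcomp : mem_PRel_of_polyTimeTuringReducible` of
`Literature.Computability.QuantumComplexity.PRelClass_PRelClass_subset` (`QuantumComplexity/IQPPostselection.lean:296`,
used at `:346`, `:367` and `PostBQPToPostIQP.lean:98`) can be dropped; `PRelClass_PRelClass_subset_self`
below is its unconditional `CplxCore` form. Likewise the `OracleAlg.isPolyTime_compose`-conditional
users of `OracleComposition.lean` may take the facts from here.

## References

* R. E. Ladner, N. A. Lynch, A. L. Selman, *A comparison of polynomial time reducibilities*,
  Theoret. Comput. Sci. 1 (1975) 103–123, §2 (transitivity of `≤ᵀᴾ`, Prop. 2.1).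
* S. Arora, B. Barak, *Computational Complexity: A Modern Approach*, CUP 2009, §3.4 (oracle
  machines), §1.4.1 (clocked universal simulation), Thm. 2.8 (composition).
* M. J. Bremner, R. Jozsa, D. J. Shepherd, Proc. R. Soc. A 467 (2011) 459–472, §3.1
  (`P^{(P^C)} = P^C`).
-/

namespace Literature.Computability.Complexity

open _root_.Computability Polynomial PRelSigma

namespace OracleCompose

/-! ### Prefix structure of free-running transcripts -/

section TransLemmas

variable {β : Type}

/-- Free-running transcripts are prefix-closed. [folklore] -/
theorem trans_take (M : OracleAlg β) (O : Oracle) (y : List Bool) :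
    ∀ {k l : ℕ}, l ≤ k → (trans M O y k).take l = trans M O y l
  | 0, l, h => by
    obtain rfl : l = 0 := Nat.le_zero.1 h
    rfl
  | k + 1, l, h => by
    rcases Nat.lt_or_ge l (k + 1) with hl | hl
    · rw [trans_succ, List.take_append_of_le_length (by rw [length_trans']; omega)]
      exact trans_take M O y (by omega)
    · obtain rfl : l = k + 1 := le_antisymm h hl
      exact List.take_of_length_le (by rw [length_trans'])
where
  /-- The free-running transcript of `k` rounds has `k` answers. [folklore] -/
  length_trans' {k : ℕ} : (trans M O y k).length = k := by
    induction k with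
    | zero => rfl
    | succ k ih => rw [trans_succ, List.length_append, ih]; rfl

/-- The free-running transcript of `k` rounds has `k` answers. [folklore] -/
@[simp] theorem length_trans (M : OracleAlg β) (O : Oracle) (y : List Bool) (k : ℕ) :
    (trans M O y k).length = k :=
  trans_take.length_trans' M O y

/-- The `l`-th answer of the free-running transcript is the oracle's answer to the `l`-th query.
[folklore] -/
theorem getElem?_trans (M : OracleAlg β) (O : Oracle) (y : List Bool) {k l : ℕ} (h : l < k) :
    (trans M O y k)[l]? = some (O (qryOf M y (trans M O y l))) := by
  have ht := trans_take M O y (show l + 1 ≤ k from h)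
  rw [trans_succ] at ht
  have : (List.take (l + 1) (trans M O y k))[l]? = (trans M O y l ++ [O (qryOf M y (trans M O y l))])[l]? := by
    rw [ht]
  rw [List.getElem?_take_of_lt (by omega)] at this
  rw [this, List.getElem?_append_right (by rw [length_trans]), length_trans, Nat.sub_self]
  rfl

/-- Dropping `l` answers of a longer transcript leaves the `l`-th answer in front. [folklore] -/
theorem drop_trans_eq_cons (M : OracleAlg β) (O : Oracle) (y : List Bool) {k l : ℕ} (h : l < k) :
    (trans M O y k).drop l = O (qryOf M y (trans M O y l)) :: (trans M O y k).drop (l + 1) := by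
  rw [← List.getElem_cons_drop (by rw [length_trans]; exact h)]
  congr 1
  have := getElem?_trans M O y h
  rw [List.getElem?_eq_getElem (by rw [length_trans]; exact h)] at this
  exact Option.some.inj this

/-- **The queries recorded by `queriesAux` are the queries along the free-running transcript**
(converse of `mem_queriesAux_trans`). [Arora–Barak 2009, §3.4] [folklore] -/
theorem exists_of_mem_queriesAux (M : OracleAlg β) (O : Oracle) (x : List Bool) :
    ∀ (n j : ℕ) (z : List Bool), z ∈ M.queriesAux O x n (trans M O x j) →
      ∃ i, i < n ∧ (∀ i' ≤ i, ∃ y, M.step x (trans M O x (j + i')) = Sum.inl y) ∧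
        z = qryOf M x (trans M O x (j + i))
  | 0, j, z, hz => by simp [OracleAlg.queriesAux] at hz
  | n + 1, j, z, hz => by
    unfold OracleAlg.queriesAux at hz
    cases hs : M.step x (trans M O x j) with
    | inr b =>
      rw [hs] at hz
      simp at hz
    | inl y =>
      rw [hs] at hz
      simp only [List.mem_cons] at hz
      rcases hz with rfl | hz
      · exact ⟨0, by omega, fun i' hi' => by
          obtain rfl : i' = 0 := Nat.le_zero.1 hi'
          exact ⟨_, by simpa using hs⟩, by rw [add_zero, qryOf_eq_of_step_eq hs]⟩
      · have htr : trans M O x j ++ [O y] = trans M O x (j + 1) := by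
          rw [trans_succ, qryOf_eq_of_step_eq hs]
        rw [htr] at hz
        obtain ⟨i, hi, hall, hzq⟩ := exists_of_mem_queriesAux M O x n (j + 1) z hz
        refine ⟨i + 1, by omega, fun i' hi' => ?_, by rw [hzq, show j + 1 + i = j + (i + 1) by omega]⟩
        rcases i' with _ | i'
        · exact ⟨y, by simpa using hs⟩
        · rw [show j + (i' + 1) = j + 1 + i' by omega]
          exact hall i' (by omega)

/-- Every recorded query is the query of some round along the free-running transcript, all
earlier rounds being queries. [Arora–Barak 2009, §3.4] [folklore] -/
theorem exists_of_mem_queries (M : OracleAlg β) (O : Oracle) (n : ℕ) (x : List Bool) (z : List Bool)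
    (hz : z ∈ M.queries O n x) :
    ∃ i, i < n ∧ (∀ i' ≤ i, ∃ y, M.step x (trans M O x i') = Sum.inl y) ∧
      z = qryOf M x (trans M O x i) := by
  have h := exists_of_mem_queriesAux M O x n 0 z (by simpa [OracleAlg.queries] using hz)
  simpa using h

end TransLemmas

/-! ### The composite oracle algorithm (mathematical level) -/

/-- Phases of the composite simulation: about to step the outer algorithm; simulating the inner
algorithm on the outer query `y` with inner transcript `t2`; finished with step result `r`.
[Ladner–Lynch–Selman 1975, §2 (proof of transitivity of `≤ᵀᴾ`)] [folklore] -/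
inductive Phase
  | outer
  | inner (y : List Bool) (t2 : List (List Bool))
  | done (r : List Bool ⊕ Bool)

/-- States of the composite simulation: the outer answer bits `t1`, the not yet consumed answers
`rest` of the composite transcript, and the phase. [folklore] -/
structure CState where
  /-- answer bits fed to the outer algorithm so far -/
  t1 : List Bool
  /-- answers of the composite transcript not yet consumed -/
  rest : List (List Bool)
  /-- phase -/
  ph : Phase

variable (M₁ M₂ : OracleAlg Bool)

/-- **The small step of the composite simulation** (outer algorithm `M₁` with a language oracle
decided by the inner oracle algorithm `M₂`): in phase `outer`, step `M₁` on the answer bits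
(output ↦ finished; query `y` ↦ start simulating `M₂` on `y`, truncated to `c₁` symbols); in
phase `inner y t2`, step `M₂` (output `b` ↦ feed the bit `b` to `M₁`; query `z` ↦ consume the
next answer of the composite transcript, or, if there is none, finish with the query `z`
truncated to `c₂` symbols). The truncations never act on genuine runs (query-length clauses of
`PRel`) and keep the state of linear size. [Ladner–Lynch–Selman 1975, §2; Arora–Barak 2009,
§3.4] [folklore] -/
def F (x : List Bool) (c₁ c₂ : ℕ) (s : CState) : CState :=
  match s with
  | ⟨t1, rest, Phase.outer⟩ =>
    match M₁.step x (bitsTrans t1) with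
    | Sum.inr b => ⟨t1, rest, Phase.done (Sum.inr b)⟩
    | Sum.inl y => ⟨t1, rest, Phase.inner (y.take c₁) []⟩
  | ⟨t1, rest, Phase.inner y t2⟩ =>
    match M₂.step y t2 with
    | Sum.inr b => ⟨t1 ++ [b], rest, Phase.outer⟩
    | Sum.inl z =>
      match rest with
      | [] => ⟨t1, [], Phase.done (Sum.inl (z.take c₂))⟩
      | a :: rest' => ⟨t1, rest', Phase.inner y (t2 ++ [a])⟩
  | ⟨t1, rest, Phase.done r⟩ => ⟨t1, rest, Phase.done r⟩

/-- The step result read off a state: the result of a finished simulation, junk otherwise.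
[folklore] -/
def result (s : CState) : List Bool ⊕ Bool :=
  match s.ph with
  | Phase.done r => r
  | _ => Sum.inr false

/-- The number of small steps run by the composite step function on a transcript of `n` answers:
`n + 2 q₁|x| + 2`. [folklore] -/
def fuel (q₁ : Polynomial ℕ) (x : List Bool) (n : ℕ) : ℕ :=
  n + 2 * q₁.eval x.length + 2

/-- **The composite oracle algorithm** `M₁ ∘ M₂`: replay the whole simulation from the transcript
(`fuel` small steps of `F` from the initial state) and report the next query or the output.
[Ladner–Lynch–Selman 1975, §2; Arora–Barak 2009, §3.4] [folklore] -/
def compAlg (q₁ q₂ : Polynomial ℕ) : OracleAlg Bool where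
  step x ans := result ((F M₁ M₂ x (q₁.eval x.length) (q₂.eval (q₁.eval x.length)))^[fuel q₁ x ans.length]
    ⟨[], ans, Phase.outer⟩)

/-! ### Small-step lemmas -/

section Steps

variable {M₁ M₂} {x : List Bool} {c₁ c₂ : ℕ}

/-- Outer query. [folklore] -/
theorem F_outer_query {t1 : List Bool} {rest : List (List Bool)} {y : List Bool}
    (h : M₁.step x (bitsTrans t1) = Sum.inl y) :
    F M₁ M₂ x c₁ c₂ ⟨t1, rest, Phase.outer⟩ = ⟨t1, rest, Phase.inner (y.take c₁) []⟩ := by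
  simp [F, h]

/-- Outer output. [folklore] -/
theorem F_outer_output {t1 : List Bool} {rest : List (List Bool)} {b : Bool}
    (h : M₁.step x (bitsTrans t1) = Sum.inr b) :
    F M₁ M₂ x c₁ c₂ ⟨t1, rest, Phase.outer⟩ = ⟨t1, rest, Phase.done (Sum.inr b)⟩ := by
  simp [F, h]

/-- Inner output: feed the bit to the outer algorithm. [folklore] -/
theorem F_inner_output {t1 : List Bool} {rest : List (List Bool)} {y : List Bool}
    {t2 : List (List Bool)} {b : Bool} (h : M₂.step y t2 = Sum.inr b) :
    F M₁ M₂ x c₁ c₂ ⟨t1, rest, Phase.inner y t2⟩ = ⟨t1 ++ [b], rest, Phase.outer⟩ := by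
  simp [F, h]

/-- Inner query with an answer available: consume it. [folklore] -/
theorem F_inner_query_cons {t1 : List Bool} {a : List Bool} {rest : List (List Bool)} {y : List Bool}
    {t2 : List (List Bool)} {z : List Bool} (h : M₂.step y t2 = Sum.inl z) :
    F M₁ M₂ x c₁ c₂ ⟨t1, a :: rest, Phase.inner y t2⟩ = ⟨t1, rest, Phase.inner y (t2 ++ [a])⟩ := by
  simp [F, h]

/-- Inner query with no answer left: this is the next query of the composite. [folklore] -/
theorem F_inner_query_nil {t1 : List Bool} {y : List Bool} {t2 : List (List Bool)} {z : List Bool}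
    (h : M₂.step y t2 = Sum.inl z) :
    F M₁ M₂ x c₁ c₂ ⟨t1, [], Phase.inner y t2⟩ = ⟨t1, [], Phase.done (Sum.inl (z.take c₂))⟩ := by
  simp [F, h]

/-- A finished simulation is a fixed point. [folklore] -/
theorem F_done (t1 : List Bool) (rest : List (List Bool)) (r : List Bool ⊕ Bool) :
    F M₁ M₂ x c₁ c₂ ⟨t1, rest, Phase.done r⟩ = ⟨t1, rest, Phase.done r⟩ := by
  simp [F]

/-- A finished simulation is a fixed point of all iterates. [folklore] -/
theorem iterate_F_done (n : ℕ) (t1 : List Bool) (rest : List (List Bool)) (r : List Bool ⊕ Bool) :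
    (F M₁ M₂ x c₁ c₂)^[n] ⟨t1, rest, Phase.done r⟩ = ⟨t1, rest, Phase.done r⟩ := by
  induction n with
  | zero => rfl
  | succ n ih => rw [Function.iterate_succ_apply, F_done, ih]

/-- Extra fuel does not change a finished simulation. [folklore] -/
theorem iterate_F_of_done {n m : ℕ} (hnm : n ≤ m) {s : CState} {t1 : List Bool}
    {rest : List (List Bool)} {r : List Bool ⊕ Bool}
    (h : (F M₁ M₂ x c₁ c₂)^[n] s = ⟨t1, rest, Phase.done r⟩) :
    (F M₁ M₂ x c₁ c₂)^[m] s = ⟨t1, rest, Phase.done r⟩ := by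
  obtain ⟨d, rfl⟩ := Nat.exists_eq_add_of_le hnm
  rw [add_comm, Function.iterate_add_apply, h, iterate_F_done]

/-- **Consuming a block of inner answers.** Along the true inner transcript `B = trans M₂ O y m`
(all of whose first `m` steps are queries), `n` small steps from position `l` consume `n`
answers. [Ladner–Lynch–Selman 1975, §2] [folklore] -/
theorem iterate_F_inner {O : Oracle} {y : List Bool} {m : ℕ}
    (hsteps : ∀ l < m, ∃ z, M₂.step y (trans M₂ O y l) = Sum.inl z)
    (t1 : List Bool) (rest' : List (List Bool)) :
    ∀ (n l : ℕ), l + n ≤ m →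
      (F M₁ M₂ x c₁ c₂)^[n] ⟨t1, (trans M₂ O y m).drop l ++ rest', Phase.inner y (trans M₂ O y l)⟩ =
        ⟨t1, (trans M₂ O y m).drop (l + n) ++ rest', Phase.inner y (trans M₂ O y (l + n))⟩
  | 0, l, _ => rfl
  | n + 1, l, h => by
    obtain ⟨z, hz⟩ := hsteps l (by omega)
    rw [Function.iterate_succ_apply, drop_trans_eq_cons M₂ O y (show l < m by omega), List.cons_append,
      F_inner_query_cons hz, ← trans_succ,
      iterate_F_inner hsteps t1 rest' n (l + 1) (by omega), show l + 1 + n = l + (n + 1) by omega]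

end Steps

/-! ### The genuine composite run -/

section Run

variable {M₁ M₂} {A : Language Bool} {O : Oracle} {x : List Bool} {c₁ c₂ : ℕ}

/-- Concatenation of the first `j` blocks. [folklore] -/
def PB (Bl : ℕ → List (List Bool)) : ℕ → List (List Bool)
  | 0 => []
  | j + 1 => PB Bl j ++ Bl j

/-- Small steps needed for the first `j` blocks: `Σ_{j' < j} (k j' + 2)`. [folklore] -/
def SB (k : ℕ → ℕ) : ℕ → ℕ
  | 0 => 0
  | j + 1 => SB k j + (k j + 2)

/-- `SB k j = |PB j| + 2 j` when block `j'` has length `k j'`. [folklore] -/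
theorem SB_eq (Bl : ℕ → List (List Bool)) (k : ℕ → ℕ) (hk : ∀ j, (Bl j).length = k j) :
    ∀ j, SB k j = (PB Bl j).length + 2 * j
  | 0 => rfl
  | j + 1 => by
    rw [SB, PB, List.length_append, hk, SB_eq Bl k hk j]
    ring

variable (M₁ A x) in
/-- The `j`-th query of the outer algorithm `M₁` run with the language oracle of `A`. [folklore] -/
noncomputable def oq (j : ℕ) : List Bool :=
  qryOf M₁ x (PRelSigma.trans M₁ (Oracle.ofLanguage A) x j)

variable (M₁ M₂ A O x) in
/-- The `l`-th query of the inner algorithm `M₂` (oracle `O`) simulated on the `j`-th outer query.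
[folklore] -/
noncomputable def iq (j l : ℕ) : List Bool :=
  qryOf M₂ (oq M₁ A x j) (PRelSigma.trans M₂ O (oq M₁ A x j) l)

variable (M₁ M₂ A O x c₁ c₂) in
/-- The data of a genuine composite run at input `x`: the outer algorithm `M₁` with the language
oracle of `A` halts after `m₁` query rounds with output `b`; on its `j`-th query the inner
algorithm `M₂` with oracle `O` halts after `k j` query rounds with the membership bit; all
queries are short. [Ladner–Lynch–Selman 1975, §2] [folklore] -/
structure RunData where
  /-- number of outer query rounds -/
  m₁ : ℕ
  /-- output of the outer algorithm -/
  b : Bool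
  /-- number of inner query rounds on the `j`-th outer query -/
  k : ℕ → ℕ
  /-- the outer rounds `< m₁` are queries -/
  outer_query : ∀ j < m₁, ∃ y, M₁.step x (PRelSigma.trans M₁ (Oracle.ofLanguage A) x j) = Sum.inl y
  /-- the outer round `m₁` outputs `b` -/
  outer_output : M₁.step x (PRelSigma.trans M₁ (Oracle.ofLanguage A) x m₁) = Sum.inr b
  /-- the outer queries are short -/
  outer_len : ∀ j < m₁, (oq M₁ A x j).length ≤ c₁
  /-- the inner rounds `< k j` are queries -/
  inner_query : ∀ j < m₁, ∀ l < k j,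
    ∃ z, M₂.step (oq M₁ A x j) (PRelSigma.trans M₂ O (oq M₁ A x j) l) = Sum.inl z
  /-- the inner round `k j` outputs the membership bit -/
  inner_output : ∀ j < m₁,
    M₂.step (oq M₁ A x j) (PRelSigma.trans M₂ O (oq M₁ A x j) (k j)) =
      Sum.inr (A.boolIndicator (oq M₁ A x j))
  /-- the inner queries are short -/
  inner_len : ∀ j < m₁, ∀ l < k j, (iq M₁ M₂ A O x j l).length ≤ c₂

namespace RunData

variable (D : RunData M₁ M₂ A O x c₁ c₂)

/-- Block `j` of the composite transcript: the inner answers on the `j`-th outer query. [folklore] -/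
noncomputable def Bl (D : RunData M₁ M₂ A O x c₁ c₂) (j : ℕ) : List (List Bool) :=
  PRelSigma.trans M₂ O (oq M₁ A x j) (D.k j)

/-- The composite transcript before block `j`. [folklore] -/
noncomputable def pre (D : RunData M₁ M₂ A O x c₁ c₂) (j : ℕ) : List (List Bool) :=
  PB D.Bl j

/-- Block `j` has `k j` answers. [folklore] -/
@[simp] theorem length_Bl (j : ℕ) : (D.Bl j).length = D.k j :=
  length_trans _ _ _ _

/-- `pre (j+1) = pre j ++ Bl j`. [folklore] -/
theorem pre_succ (j : ℕ) : D.pre (j + 1) = D.pre j ++ D.Bl j := rfl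

/-- `pre 0 = []`. [folklore] -/
@[simp] theorem pre_zero : D.pre 0 = [] := rfl

/-- Step count versus transcript length. [folklore] -/
theorem SB_eq_length (j : ℕ) : SB D.k j = (D.pre j).length + 2 * j :=
  SB_eq D.Bl D.k D.length_Bl j

/-- The outer answer bits form the outer transcript. [folklore] -/
theorem bitsTrans_answerBits (j : ℕ) :
    bitsTrans (answerBits M₁ A x j) = PRelSigma.trans M₁ (Oracle.ofLanguage A) x j :=
  (trans_eq_bitsTrans_answerBits M₁ A x j).symm

/-- **The outer loop**: `SB j` small steps consume the first `j` blocks and leave the outer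
algorithm with its first `j` answer bits. [Ladner–Lynch–Selman 1975, §2] [folklore] -/
theorem iterate_F_outer : ∀ j ≤ D.m₁, ∀ rest' : List (List Bool),
    (F M₁ M₂ x c₁ c₂)^[SB D.k j] ⟨[], D.pre j ++ rest', Phase.outer⟩ =
      ⟨answerBits M₁ A x j, rest', Phase.outer⟩
  | 0, _, rest' => by simp [SB, answerBits]
  | j + 1, hj, rest' => by
    have ih := iterate_F_outer j (by omega) (D.Bl j ++ rest')
    rw [SB, add_comm (SB D.k j), Function.iterate_add_apply, pre_succ, List.append_assoc, ih]
    -- one outer step: the query `oq j`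
    obtain ⟨yj, hyj⟩ := D.outer_query j (by omega)
    have hy : yj = oq M₁ A x j := (qryOf_eq_of_step_eq hyj).symm
    rw [show D.k j + 2 = (D.k j + 1) + 1 by ring, Function.iterate_succ_apply,
      F_outer_query (by rw [bitsTrans_answerBits]; exact hyj), hy,
      List.take_of_length_le (D.outer_len j (by omega))]
    -- the inner block
    rw [Function.iterate_succ_apply', show D.Bl j ++ rest' =
      (PRelSigma.trans M₂ O (oq M₁ A x j) (D.k j)).drop 0 ++ rest' from rfl,
      show ([] : List (List Bool)) = PRelSigma.trans M₂ O (oq M₁ A x j) 0 from rfl,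
      iterate_F_inner (D.inner_query j (by omega)) _ rest' (D.k j) 0 (by omega)]
    simp only [zero_add]
    rw [List.drop_of_length_le (by rw [length_trans]), List.nil_append,
      F_inner_output (D.inner_output j (by omega)), answerBits_succ]
    rfl

/-- **A query position**: on the transcript `pre j ++ (Bl j ↾ l)` with `l < k j`, the composite
simulation finishes within `SB j + l + 2` small steps with the inner query `iq j l`.
[Ladner–Lynch–Selman 1975, §2] [folklore] -/
theorem iterate_F_query {j : ℕ} (hj : j < D.m₁) {l : ℕ} (hl : l < D.k j) :
    (F M₁ M₂ x c₁ c₂)^[SB D.k j + (l + 2)] ⟨[], D.pre j ++ (D.Bl j).take l, Phase.outer⟩ =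
      ⟨answerBits M₁ A x j, [], Phase.done (Sum.inl (iq M₁ M₂ A O x j l))⟩ := by
  rw [add_comm (SB D.k j), Function.iterate_add_apply, D.iterate_F_outer j hj.le]
  obtain ⟨yj, hyj⟩ := D.outer_query j hj
  have hy : yj = oq M₁ A x j := (qryOf_eq_of_step_eq hyj).symm
  rw [show l + 2 = (l + 1) + 1 by ring, Function.iterate_succ_apply,
    F_outer_query (by rw [bitsTrans_answerBits]; exact hyj), hy,
    List.take_of_length_le (D.outer_len j hj)]
  have htake : (D.Bl j).take l = PRelSigma.trans M₂ O (oq M₁ A x j) l :=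
    trans_take M₂ O (oq M₁ A x j) hl.le
  have hinner := iterate_F_inner (M₁ := M₁) (x := x) (c₁ := c₁) (c₂ := c₂) (m := l)
    (fun l' hl' => D.inner_query j hj l' (by omega)) (answerBits M₁ A x j) [] l 0 (by omega)
  simp only [zero_add, List.drop_zero, List.append_nil, trans_zero] at hinner
  rw [List.drop_of_length_le (by rw [length_trans])] at hinner
  rw [Function.iterate_succ_apply', htake, hinner]
  obtain ⟨zz, hzz⟩ := D.inner_query j hj l hl
  rw [F_inner_query_nil hzz]
  have hz : zz = iq M₁ M₂ A O x j l := (qryOf_eq_of_step_eq hzz).symm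
  rw [hz, List.take_of_length_le (D.inner_len j hj l hl)]

/-- **The final position**: on the full transcript `pre m₁` the composite simulation finishes
within `SB m₁ + 1` small steps with the output of the outer algorithm.
[Ladner–Lynch–Selman 1975, §2] [folklore] -/
theorem iterate_F_final :
    (F M₁ M₂ x c₁ c₂)^[SB D.k D.m₁ + 1] ⟨[], D.pre D.m₁, Phase.outer⟩ =
      ⟨answerBits M₁ A x D.m₁, [], Phase.done (Sum.inr D.b)⟩ := by
  rw [Function.iterate_succ_apply']
  have h := D.iterate_F_outer D.m₁ le_rfl []
  rw [List.append_nil] at h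
  rw [h]
  exact F_outer_output (by rw [bitsTrans_answerBits]; exact D.outer_output)

end RunData

end Run

/-! ### The composite algorithm follows the genuine run -/

section Follow

variable {M₁ M₂} {A : Language Bool} {O : Oracle} {x : List Bool} {q₁ q₂ : Polynomial ℕ}

/-- Abbreviation: the composite algorithm with its truncation lengths at `x`. [folklore] -/
theorem compAlg_step (ans : List (List Bool)) :
    (compAlg M₁ M₂ q₁ q₂).step x ans =
      result ((F M₁ M₂ x (q₁.eval x.length) (q₂.eval (q₁.eval x.length)))^[fuel q₁ x ans.length]
        ⟨[], ans, Phase.outer⟩) :=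
  rfl

variable (D : RunData M₁ M₂ A O x (q₁.eval x.length) (q₂.eval (q₁.eval x.length)))
  (hm₁ : D.m₁ ≤ q₁.eval x.length)

include hm₁

/-- **The composite step at a query position** asks the inner query. [Ladner–Lynch–Selman 1975, §2] [folklore] -/
theorem compAlg_step_query {j : ℕ} (hj : j < D.m₁) {l : ℕ} (hl : l < D.k j) :
    (compAlg M₁ M₂ q₁ q₂).step x (D.pre j ++ (D.Bl j).take l) = Sum.inl (iq M₁ M₂ A O x j l) := by
  rw [compAlg_step]
  have hle : SB D.k j + (l + 2) ≤ fuel q₁ x (D.pre j ++ (D.Bl j).take l).length := by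
    rw [fuel, D.SB_eq_length, List.length_append, List.length_take, D.length_Bl, min_eq_left hl.le]
    omega
  rw [iterate_F_of_done hle (D.iterate_F_query hj hl)]
  rfl

/-- **The composite step at the final position** outputs the outer output. [Ladner–Lynch–Selman 1975, §2] [folklore] -/
theorem compAlg_step_final :
    (compAlg M₁ M₂ q₁ q₂).step x (D.pre D.m₁) = Sum.inr D.b := by
  rw [compAlg_step]
  have hle : SB D.k D.m₁ + 1 ≤ fuel q₁ x (D.pre D.m₁).length := by
    rw [fuel, D.SB_eq_length]
    omega
  rw [iterate_F_of_done hle D.iterate_F_final]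
  rfl

/-- **The composite transcript is the concatenation of the blocks**: after `|pre j| + l` rounds
(`l ≤ k j`) the composite algorithm has received `pre j ++ (Bl j ↾ l)`. [Ladner–Lynch–Selman 1975, §2] [folklore] -/
theorem trans_compAlg : ∀ j ≤ D.m₁,
    PRelSigma.trans (compAlg M₁ M₂ q₁ q₂) O x (D.pre j).length = D.pre j ∧
    (j < D.m₁ → ∀ l ≤ D.k j,
      PRelSigma.trans (compAlg M₁ M₂ q₁ q₂) O x ((D.pre j).length + l) = D.pre j ++ (D.Bl j).take l)
  | 0, _ => by
    refine ⟨by simp, fun hj => ?_⟩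
    intro l
    induction l with
    | zero => intro; simp
    | succ l ih =>
      intro hl
      have ih' := ih (by omega)
      simp only [RunData.pre_zero, List.length_nil, zero_add, List.nil_append] at ih' ⊢
      rw [trans_succ, ih', ← List.nil_append ((D.Bl 0).take l), ← D.pre_zero,
        qryOf_eq_of_step_eq (compAlg_step_query D hm₁ hj (show l < D.k 0 by omega)), RunData.pre_zero,
        List.nil_append, List.take_add_one]
      congr 1
      change [O (iq M₁ M₂ A O x 0 l)] = ((PRelSigma.trans M₂ O (oq M₁ A x 0) (D.k 0))[l]?).toList
      rw [getElem?_trans M₂ O _ (show l < D.k 0 by omega)]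
      rfl
  | j + 1, hj => by
    obtain ⟨ihpre, ihblk⟩ := trans_compAlg j (by omega)
    have hfull : PRelSigma.trans (compAlg M₁ M₂ q₁ q₂) O x (D.pre (j + 1)).length = D.pre (j + 1) := by
      rw [D.pre_succ, List.length_append, D.length_Bl, ihblk (by omega) (D.k j) le_rfl,
        List.take_of_length_le (by rw [D.length_Bl])]
    refine ⟨hfull, fun hj' => ?_⟩
    intro l
    induction l with
    | zero => intro; simpa using hfull
    | succ l ih =>
      intro hl
      have ih' := ih (by omega)
      rw [← add_assoc, trans_succ, ih',
        qryOf_eq_of_step_eq (compAlg_step_query D hm₁ hj' (show l < D.k (j + 1) by omega)),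
        List.take_add_one, List.append_assoc]
      congr 2
      change [O (iq M₁ M₂ A O x (j + 1) l)] =
        ((PRelSigma.trans M₂ O (oq M₁ A x (j + 1)) (D.k (j + 1)))[l]?).toList
      rw [getElem?_trans M₂ O _ (show l < D.k (j + 1) by omega)]
      rfl

omit hm₁ in
/-- Every position below `|pre m₁|` lies in some block. [folklore] -/
theorem exists_block : ∀ (j i : ℕ), i < (D.pre j).length → ∃ j' < j, ∃ l < D.k j', i = (D.pre j').length + l
  | 0, i, hi => by simp at hi
  | j + 1, i, hi => by
    rw [D.pre_succ, List.length_append, D.length_Bl] at hi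
    rcases Nat.lt_or_ge i (D.pre j).length with h | h
    · obtain ⟨j', hj', l, hl, rfl⟩ := exists_block j i h
      exact ⟨j', by omega, l, hl, rfl⟩
    · exact ⟨j, by omega, i - (D.pre j).length, by omega, by omega⟩

omit hm₁ in
/-- The length of the full composite transcript: at most `m₁ · c` if every block has length `≤ c`.
[folklore] -/
theorem length_pre_le {c : ℕ} (hk : ∀ j < D.m₁, D.k j ≤ c) : ∀ j ≤ D.m₁, (D.pre j).length ≤ j * c
  | 0, _ => by simp
  | j + 1, hj => by
    rw [D.pre_succ, List.length_append, D.length_Bl, Nat.succ_mul]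
    have := length_pre_le hk j (by omega)
    have := hk j (by omega)
    omega

/-- **The composite algorithm runs like the genuine composite run**: with any budget exceeding
`|pre m₁|` it outputs the outer output. [Ladner–Lynch–Selman 1975, §2] [folklore] -/
theorem run_compAlg {n : ℕ} (hn : (D.pre D.m₁).length < n) :
    (compAlg M₁ M₂ q₁ q₂).run O n x = some D.b := by
  rw [run_eq_some_iff]
  refine ⟨(D.pre D.m₁).length, hn, fun i hi => ?_, ?_⟩
  · obtain ⟨j, hj, l, hl, rfl⟩ := exists_block D D.m₁ i hi
    refine ⟨iq M₁ M₂ A O x j l, ?_⟩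
    rw [((trans_compAlg D hm₁ j hj.le).2 hj) l hl.le]
    exact compAlg_step_query D hm₁ hj hl
  · rw [(trans_compAlg D hm₁ D.m₁ le_rfl).1]
    exact compAlg_step_final D hm₁

/-- **The queries of the composite algorithm are inner queries.** [Ladner–Lynch–Selman 1975, §2] [folklore] -/
theorem mem_queries_compAlg {n : ℕ} {z : List Bool} (hz : z ∈ (compAlg M₁ M₂ q₁ q₂).queries O n x) :
    ∃ j < D.m₁, ∃ l < D.k j, z = iq M₁ M₂ A O x j l := by
  obtain ⟨i, -, hall, rfl⟩ := exists_of_mem_queries _ O n x z hz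
  have hi : i < (D.pre D.m₁).length := by
    by_contra h
    obtain ⟨y, hy⟩ := hall (D.pre D.m₁).length (by omega)
    rw [(trans_compAlg D hm₁ D.m₁ le_rfl).1, compAlg_step_final D hm₁] at hy
    cases hy
  obtain ⟨j, hj, l, hl, rfl⟩ := exists_block D D.m₁ i hi
  refine ⟨j, hj, l, hl, ?_⟩
  rw [((trans_compAlg D hm₁ j hj.le).2 hj) l hl.le]
  exact qryOf_eq_of_step_eq (compAlg_step_query D hm₁ hj hl)

end Follow

/-! ### The genuine run exists under the `PRel` hypotheses -/

section Data

variable {M₁ M₂} {A L : Language Bool} {O : Oracle} {q₁ q₂ : Polynomial ℕ}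

/-- **Run data from the `PRel` clauses**: if `M₁` decides `L` with the language oracle of `A`
(budget `q₁`) and `M₂` decides `A` with oracle `O` (budget `q₂`), then at every input the genuine
composite run exists, with `m₁ < q₁|x|` outer rounds, `k j < q₂(q₁|x|)` inner rounds per block
and output `[x ∈ L]`. [Ladner–Lynch–Selman 1975, §2] [folklore] -/
theorem exists_runData
    (hq₁ : ∀ x : List Bool, M₁.run (Oracle.ofLanguage A) (q₁.eval x.length) x = some (L.boolIndicator x) ∧
      ∀ y ∈ M₁.queries (Oracle.ofLanguage A) (q₁.eval x.length) x, y.length ≤ q₁.eval x.length)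
    (hq₂ : ∀ y : List Bool, M₂.run O (q₂.eval y.length) y = some (A.boolIndicator y) ∧
      ∀ z ∈ M₂.queries O (q₂.eval y.length) y, z.length ≤ q₂.eval y.length)
    (x : List Bool) :
    ∃ D : RunData M₁ M₂ A O x (q₁.eval x.length) (q₂.eval (q₁.eval x.length)),
      D.b = L.boolIndicator x ∧ D.m₁ < q₁.eval x.length ∧ ∀ j < D.m₁, D.k j < q₂.eval (q₁.eval x.length) := by
  classical
  obtain ⟨m₁, hm₁, houter, hfin⟩ := (run_eq_some_iff M₁ _ _ x _).1 (hq₁ x).1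
  -- outer queries are genuine, hence short
  have hlen₁ : ∀ j < m₁, (oq M₁ A x j).length ≤ q₁.eval x.length := fun j hj =>
    (hq₁ x).2 _ (mem_queries_of_trans M₁ _ _ x j (by omega) fun i' hi' => houter i' (by omega))
  -- inner runs
  have hinner : ∀ j, ∃ kj, j < m₁ → kj < q₂.eval (oq M₁ A x j).length ∧
      (∀ l < kj, ∃ z, M₂.step (oq M₁ A x j) (PRelSigma.trans M₂ O (oq M₁ A x j) l) = Sum.inl z) ∧
      M₂.step (oq M₁ A x j) (PRelSigma.trans M₂ O (oq M₁ A x j) kj) =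
        Sum.inr (A.boolIndicator (oq M₁ A x j)) := by
    intro j
    by_cases hj : j < m₁
    · obtain ⟨kj, hkj, hq, hf⟩ := (run_eq_some_iff M₂ O _ (oq M₁ A x j) _).1 (hq₂ (oq M₁ A x j)).1
      exact ⟨kj, fun _ => ⟨hkj, hq, hf⟩⟩
    · exact ⟨0, fun h => absurd h hj⟩
  choose k hk using hinner
  have hkq : ∀ j < m₁, k j < q₂.eval (q₁.eval x.length) := fun j hj =>
    lt_of_lt_of_le (hk j hj).1 (TM2Iter.eval_mono q₂ (hlen₁ j hj))
  refine ⟨⟨m₁, L.boolIndicator x, k, houter, hfin, hlen₁, fun j hj => (hk j hj).2.1,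
    fun j hj => (hk j hj).2.2, fun j hj l hl => ?_⟩, rfl, hm₁, hkq⟩
  -- inner queries are genuine, hence short
  have hz : iq M₁ M₂ A O x j l ∈ M₂.queries O (q₂.eval (oq M₁ A x j).length) (oq M₁ A x j) :=
    mem_queries_of_trans M₂ O _ _ l (by have := (hk j hj).1; omega)
      fun i' hi' => (hk j hj).2.1 i' (by omega)
  exact ((hq₂ _).2 _ hz).trans (TM2Iter.eval_mono q₂ (hlen₁ j hj))

/-- The round/query budget of the composite algorithm: `q₁ · (q₂ ∘ q₁) + q₂ ∘ q₁ + 1`. [folklore] -/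
noncomputable def budget (q₁ q₂ : Polynomial ℕ) : Polynomial ℕ :=
  q₁ * q₂.comp q₁ + q₂.comp q₁ + 1

/-- Evaluation of the budget. [folklore] -/
theorem budget_eval (q₁ q₂ : Polynomial ℕ) (n : ℕ) :
    (budget q₁ q₂).eval n = q₁.eval n * q₂.eval (q₁.eval n) + q₂.eval (q₁.eval n) + 1 := by
  simp [budget, eval_comp]

/-- **Correctness of the composite algorithm**: it decides `L` with oracle `O` within the budget,
asking only short queries. [Ladner–Lynch–Selman 1975, §2] [folklore] -/
theorem compAlg_correct
    (hq₁ : ∀ x : List Bool, M₁.run (Oracle.ofLanguage A) (q₁.eval x.length) x = some (L.boolIndicator x) ∧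
      ∀ y ∈ M₁.queries (Oracle.ofLanguage A) (q₁.eval x.length) x, y.length ≤ q₁.eval x.length)
    (hq₂ : ∀ y : List Bool, M₂.run O (q₂.eval y.length) y = some (A.boolIndicator y) ∧
      ∀ z ∈ M₂.queries O (q₂.eval y.length) y, z.length ≤ q₂.eval y.length)
    (x : List Bool) :
    (compAlg M₁ M₂ q₁ q₂).run O ((budget q₁ q₂).eval x.length) x = some (L.boolIndicator x) ∧
      ∀ z ∈ (compAlg M₁ M₂ q₁ q₂).queries O ((budget q₁ q₂).eval x.length) x,
        z.length ≤ (budget q₁ q₂).eval x.length := by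
  obtain ⟨D, hb, hm₁, hk⟩ := exists_runData hq₁ hq₂ x
  have hpre : (D.pre D.m₁).length < (budget q₁ q₂).eval x.length := by
    have h := length_pre_le D (fun j hj => (hk j hj).le) D.m₁ le_rfl
    rw [budget_eval]
    have : D.m₁ * q₂.eval (q₁.eval x.length) ≤ q₁.eval x.length * q₂.eval (q₁.eval x.length) :=
      Nat.mul_le_mul_right _ hm₁.le
    omega
  refine ⟨by rw [run_compAlg D hm₁.le hpre, hb], fun z hz => ?_⟩
  obtain ⟨j, hj, l, hl, rfl⟩ := mem_queries_compAlg D hm₁.le hz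
  have := D.inner_len j hj l hl
  rw [budget_eval]
  omega

end Data

/-! ### String toolkit: parse bounds, concatenation, selection, padding -/

section Tools

/-- **Parsing never inflates**: `2 |(boolUnpair w).1| + |(boolUnpair w).2| ≤ |w|` for every string
(equality on well-formed pairs). [Arora–Barak 2009, §0.1] [folklore] -/
theorem length_boolUnpair_le : ∀ w : List Bool,
    2 * (boolUnpair w).1.length + (boolUnpair w).2.length ≤ w.length
  | [] => by simp [boolUnpair]
  | [b] => by simp [boolUnpair]
  | b :: b' :: rest => by
    have ih := length_boolUnpair_le rest
    by_cases h : b = b'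
    · subst h
      simp only [boolUnpair, if_true, List.length_cons]
      omega
    · cases b'
      · simp [boolUnpair, h]
      · simp [boolUnpair, h]; omega

/-- First components are at most half as long as the string. [folklore] -/
theorem two_mul_length_boolUnpair_fst_le (w : List Bool) : 2 * (boolUnpair w).1.length ≤ w.length :=
  le_trans (Nat.le_add_right _ _) (length_boolUnpair_le w)

/-- Second components are at most as long as the string. [folklore] -/
theorem length_boolUnpair_snd_le_length (w : List Bool) : (boolUnpair w).2.length ≤ w.length :=
  le_trans (Nat.le_add_left _ _) (length_boolUnpair_le w)

/-- Re-pairing the parse costs at most two symbols. [folklore] -/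
theorem length_rePair_le (w : List Bool) :
    (boolPair (boolUnpair w).1 (boolUnpair w).2).length ≤ w.length + 2 := by
  rw [length_boolPair]
  have := length_boolUnpair_le w
  omega

/-! #### Concatenation of the two components -/

/-- States of the concatenation transducer. [folklore] -/
inductive CS
  | ev0
  | ev1 (b : Bool)
  | tl
  deriving DecidableEq, Fintype

/-- The concatenation transducer: on `boolPair u v` emit `u ++ v` (un-double the first component,
drop the separator, copy the rest). Re-proved copy: the twin `EmptySim.concatT` with the same
specification `EmptySim.concatT_eval` landed concurrently in the sibling `OracleEmpty.lean`
(see the module's `refactor:` note; this file additionally needs the length bound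
`length_concatT_run_le`). [Hopcroft–Ullman 1979, §2.7] [folklore] -/
def concatT : FST CS Bool Bool where
  init := CS.ev0
  step := fun s c =>
    match s with
    | CS.ev0 => (CS.ev1 c, [])
    | CS.ev1 b => if b = c then (CS.ev0, [b]) else (CS.tl, [])
    | CS.tl => (CS.tl, [c])
  front := fun _ => []
  keep := fun _ => true

/-- In the tail `concatT` copies. [folklore] -/
theorem concatT_run_tl (v : List Bool) : concatT.run CS.tl v = (CS.tl, v) := by
  induction v with
  | nil => rfl
  | cons c v ih => rw [FST.run_cons, show concatT.step CS.tl c = (CS.tl, [c]) from rfl, ih]; rfl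

/-- On a doubled prefix `concatT` emits the un-doubled symbols. [folklore] -/
theorem concatT_run_ev0_dup (u l : List Bool) :
    concatT.run CS.ev0 ((u.flatMap fun b => [b, b]) ++ l) =
      ((concatT.run CS.ev0 l).1, u ++ (concatT.run CS.ev0 l).2) := by
  induction u with
  | nil => simp
  | cons b u ih =>
    simp only [List.flatMap_cons, List.cons_append, List.nil_append, FST.run_cons]
    rw [show concatT.step CS.ev0 b = (CS.ev1 b, []) from rfl]
    simp only [show concatT.step (CS.ev1 b) b = (CS.ev0, [b]) by simp [concatT]]
    rw [ih]
    simp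

/-- **`concatT` on `boolPair u v` emits `u ++ v`** (twin of `EmptySim.concatT_eval`,
`OracleEmpty.lean`). [folklore] -/
theorem concatT_eval_boolPair (u v : List Bool) : concatT.eval (boolPair u v) = u ++ v := by
  have hsep : concatT.run CS.ev0 (false :: true :: v) = (CS.tl, v) := by
    rw [FST.run_cons, show concatT.step CS.ev0 false = (CS.ev1 false, []) from rfl]
    simp only [FST.run_cons, show concatT.step (CS.ev1 false) true = (CS.tl, []) by simp [concatT],
      concatT_run_tl]
    simp
  have hrun := concatT_run_ev0_dup u (false :: true :: v)
  rw [hsep] at hrun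
  have hb : boolPair u v = (u.flatMap fun b => [b, b]) ++ (false :: true :: v) := by simp [boolPair]
  simp only [FST.eval, show concatT.init = CS.ev0 from rfl, show ∀ s, concatT.keep s = true from
    fun _ => rfl, show ∀ s, concatT.front s = [] from fun _ => rfl, hb, hrun]
  simp

/-- `concatT` emits at most one symbol per input symbol. [folklore] -/
theorem length_concatT_run_le (s : CS) (w : List Bool) : (concatT.run s w).2.length ≤ w.length := by
  induction w generalizing s with
  | nil => simp
  | cons c w ih =>
    rw [FST.run_cons, List.length_append, List.length_cons]
    have h1 : (concatT.step s c).2.length ≤ 1 := by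
      cases s with
      | ev0 => simp [concatT]
      | ev1 b => by_cases h : b = c <;> simp [concatT, h]
      | tl => simp [concatT]
    have := ih (concatT.step s c).1
    omega

/-- The concatenation map `⟨u, v⟩ ↦ u ++ v` (total: `concatT.eval`). [folklore] -/
def concatFn : List Bool → List Bool := concatT.eval

/-- **`concatFn ⟨u, v⟩ = u ++ v`.** [folklore] -/
@[simp] theorem concatFn_boolPair (u v : List Bool) : concatFn (boolPair u v) = u ++ v :=
  concatT_eval_boolPair u v

/-- `concatFn ∈ FP`. [folklore] -/
theorem concatFn_mem_FP : concatFn ∈ FP := concatT.polyTimeComputable_eval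

/-- `concatFn` never inflates. [folklore] -/
theorem length_concatFn_le (w : List Bool) : (concatFn w).length ≤ w.length := by
  simp only [concatFn, FST.eval, show ∀ s, concatT.keep s = true from fun _ => rfl,
    show ∀ s, concatT.front s = [] from fun _ => rfl, List.nil_append, if_true]
  exact length_concatT_run_le _ w

/-! #### Selecting one of two computed strings -/

/-- States of the selector. [folklore] -/
inductive SS
  | s0
  | s1
  | s3 (c : Bool)
  | s4 (c : Bool)
  | cu0
  | cu1 (d : Bool)
  | dead
  | ku0
  | ku1 (d : Bool)
  | tl
  deriving DecidableEq, Fintype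

/-- The selector transducer: on `boolPair [c] (boolPair u v)` emit `u` if `c = 1` and `v` if
`c = 0`. [Hopcroft–Ullman 1979, §2.7] [folklore] -/
def selT : FST SS Bool Bool where
  init := SS.s0
  step := fun s c =>
    match s with
    | SS.s0 => (SS.s1, [])
    | SS.s1 => (SS.s3 c, [])
    | SS.s3 b => (SS.s4 b, [])
    | SS.s4 b => (if b then SS.cu0 else SS.ku0, [])
    | SS.cu0 => (SS.cu1 c, [])
    | SS.cu1 d => if d = c then (SS.cu0, [d]) else (SS.dead, [])
    | SS.dead => (SS.dead, [])
    | SS.ku0 => (SS.ku1 c, [])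
    | SS.ku1 d => if d = c then (SS.ku0, []) else (SS.tl, [])
    | SS.tl => (SS.tl, [c])
  front := fun _ => []
  keep := fun _ => true

/-- Reading the selector bit and the separator. [folklore] -/
theorem selT_run_prefix (c : Bool) (w : List Bool) :
    selT.run SS.s0 (c :: c :: false :: true :: w) = selT.run (if c then SS.cu0 else SS.ku0) w := by
  simp only [FST.run_cons, show selT.step SS.s0 c = (SS.s1, []) from rfl,
    show selT.step SS.s1 c = (SS.s3 c, []) from rfl, show selT.step (SS.s3 c) false = (SS.s4 c, []) from rfl,
    show selT.step (SS.s4 c) true = (if c then SS.cu0 else SS.ku0, []) from rfl, List.nil_append]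

/-- `dead` discards. [folklore] -/
theorem selT_run_dead (w : List Bool) : selT.run SS.dead w = (SS.dead, []) := by
  induction w with
  | nil => rfl
  | cons c w ih => rw [FST.run_cons, show selT.step SS.dead c = (SS.dead, []) from rfl, ih]; rfl

/-- `tl` copies. [folklore] -/
theorem selT_run_tl (w : List Bool) : selT.run SS.tl w = (SS.tl, w) := by
  induction w with
  | nil => rfl
  | cons c w ih => rw [FST.run_cons, show selT.step SS.tl c = (SS.tl, [c]) from rfl, ih]; rfl

/-- Copy mode un-doubles. [folklore] -/
theorem selT_run_cu0_dup (u l : List Bool) :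
    selT.run SS.cu0 ((u.flatMap fun b => [b, b]) ++ l) = ((selT.run SS.cu0 l).1, u ++ (selT.run SS.cu0 l).2) := by
  induction u with
  | nil => simp
  | cons b u ih =>
    simp only [List.flatMap_cons, List.cons_append, List.nil_append, FST.run_cons]
    rw [show selT.step SS.cu0 b = (SS.cu1 b, []) from rfl]
    simp only [show selT.step (SS.cu1 b) b = (SS.cu0, [b]) by simp [selT]]
    rw [ih]
    simp

/-- Skip mode emits nothing. [folklore] -/
theorem selT_run_ku0_dup (u l : List Bool) :
    selT.run SS.ku0 ((u.flatMap fun b => [b, b]) ++ l) = selT.run SS.ku0 l := by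
  induction u with
  | nil => simp
  | cons b u ih =>
    simp only [List.flatMap_cons, List.cons_append, List.nil_append, FST.run_cons]
    rw [show selT.step SS.ku0 b = (SS.ku1 b, []) from rfl]
    simp only [show selT.step (SS.ku1 b) b = (SS.ku0, []) by simp [selT]]
    rw [ih]
    simp

/-- **The selector picks the first string on `1`.** [folklore] -/
theorem selT_eval_true (u v : List Bool) : selT.eval (boolPair [true] (boolPair u v)) = u := by
  have hin : boolPair [true] (boolPair u v) =
      true :: true :: false :: true :: ((u.flatMap fun b => [b, b]) ++ (false :: true :: v)) := by
    simp [boolPair]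
  have hsep : selT.run SS.cu0 (false :: true :: v) = (SS.dead, []) := by
    rw [FST.run_cons, show selT.step SS.cu0 false = (SS.cu1 false, []) from rfl]
    simp only [FST.run_cons, show selT.step (SS.cu1 false) true = (SS.dead, []) by simp [selT], selT_run_dead]
    simp
  have hrun := selT_run_cu0_dup u (false :: true :: v)
  rw [hsep] at hrun
  simp only [FST.eval, show selT.init = SS.s0 from rfl, show ∀ s, selT.keep s = true from fun _ => rfl,
    show ∀ s, selT.front s = [] from fun _ => rfl, hin, selT_run_prefix, if_true]
  simp [hrun]

/-- **The selector picks the second string on `0`.** [folklore] -/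
theorem selT_eval_false (u v : List Bool) : selT.eval (boolPair [false] (boolPair u v)) = v := by
  have hin : boolPair [false] (boolPair u v) =
      false :: false :: false :: true :: ((u.flatMap fun b => [b, b]) ++ (false :: true :: v)) := by
    simp [boolPair]
  have hsep : selT.run SS.ku0 (false :: true :: v) = (SS.tl, v) := by
    rw [FST.run_cons, show selT.step SS.ku0 false = (SS.ku1 false, []) from rfl]
    simp only [FST.run_cons, show selT.step (SS.ku1 false) true = (SS.tl, []) by simp [selT], selT_run_tl]
    simp
  have hrun := selT_run_ku0_dup u (false :: true :: v)
  rw [hsep] at hrun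
  simp only [FST.eval, show selT.init = SS.s0 from rfl, show ∀ s, selT.keep s = true from fun _ => rfl,
    show ∀ s, selT.front s = [] from fun _ => rfl, hin, selT_run_prefix]
  simp [hrun]

/-- The selector emits at most one symbol per input symbol. [folklore] -/
theorem length_selT_run_le (s : SS) (w : List Bool) : (selT.run s w).2.length ≤ w.length := by
  induction w generalizing s with
  | nil => simp
  | cons c w ih =>
    rw [FST.run_cons, List.length_append, List.length_cons]
    have h1 : (selT.step s c).2.length ≤ 1 := by
      cases s <;> simp [selT] <;> split <;> simp
    have := ih (selT.step s c).1
    omega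

/-- `selT` never inflates. [folklore] -/
theorem length_selT_eval_le (w : List Bool) : (selT.eval w).length ≤ w.length := by
  simp only [FST.eval, show ∀ s, selT.keep s = true from fun _ => rfl,
    show ∀ s, selT.front s = [] from fun _ => rfl, List.nil_append, if_true]
  exact length_selT_run_le _ w

/-- **The `P`-guarded conditional of two polynomial-time maps**:
`condFn S f g w = if w ∈ S then f w else g w` (evaluate both, select with the indicator).
[Arora–Barak 2009, Thm. 2.8 (composition)] [folklore] -/
noncomputable def condFn (S : Language Bool) (f g : List Bool → List Bool) : List Bool → List Bool :=
  selT.eval ∘ pairFn (fun w => encodeBool (S.boolIndicator w)) (pairFn f g)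

open Classical in
/-- Semantics of the conditional. [folklore] -/
theorem condFn_apply (S : Language Bool) (f g : List Bool → List Bool) (w : List Bool) :
    condFn S f g w = if w ∈ S then f w else g w := by
  classical
  unfold condFn
  rw [Function.comp_apply, pairFn_apply, pairFn_apply]
  by_cases hw : w ∈ S
  · rw [(Set.mem_iff_boolIndicator _ _).1 hw, if_pos hw]
    exact selT_eval_true _ _
  · rw [(Set.notMem_iff_boolIndicator _ _).1 hw, if_neg hw]
    exact selT_eval_false _ _

/-- On members the conditional is the first map. [folklore] -/
theorem condFn_of_mem {S : Language Bool} (f g : List Bool → List Bool) {w : List Bool} (hw : w ∈ S) :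
    condFn S f g w = f w := by
  rw [condFn_apply, if_pos hw]

/-- Off members the conditional is the second map. [folklore] -/
theorem condFn_of_not_mem {S : Language Bool} (f g : List Bool → List Bool) {w : List Bool} (hw : w ∉ S) :
    condFn S f g w = g w := by
  rw [condFn_apply, if_neg hw]

/-- **`condFn S f g ∈ FP`** for `S ∈ P`, `f, g ∈ FP`. [Arora–Barak 2009, Thm. 2.8] [folklore] -/
theorem condFn_mem_FP {S : Language Bool} (hS : S ∈ Classes.P) {f g : List Bool → List Bool} (hf : f ∈ FP)
    (hg : g ∈ FP) : condFn S f g ∈ FP :=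
  comp_mem_FP selT.polyTimeComputable_eval (pairFn_mem_FP (indicatorFn_mem_FP hS) (pairFn_mem_FP hf hg))

/-! #### Constants, prefixes, unary pads -/

/-- The prefixing transducer. [folklore] -/
def prefixT (l : List Bool) : FST Unit Bool Bool where
  init := ()
  step := fun _ c => ((), [c])
  front := fun _ => l
  keep := fun _ => true

/-- `prefixT l` copies. [folklore] -/
theorem prefixT_run (l : List Bool) (u : Unit) (w : List Bool) : ((prefixT l).run u w).2 = w := by
  induction w generalizing u with
  | nil => rfl
  | cons c w ih => rw [FST.run_cons, show (prefixT l).step u c = ((), [c]) from rfl, ih]; rfl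

/-- `prefixT l` computes `w ↦ l ++ w`. [folklore] -/
theorem prefixT_eval (l w : List Bool) : (prefixT l).eval w = l ++ w := by
  simp [FST.eval, show ∀ s, (prefixT l).keep s = true from fun _ => rfl,
    show ∀ s, (prefixT l).front s = l from fun _ => rfl, prefixT_run]

/-- **Prefixing a constant is in `FP`.** [folklore] -/
theorem prefix_mem_FP (l : List Bool) : (fun w : List Bool => l ++ w) ∈ FP := by
  obtain ⟨p, Mx, h⟩ := (prefixT l).polyTimeComputable_eval
  exact ⟨p, Mx, fun w => by simpa [prefixT_eval] using h w⟩

/-- The identity is in `FP`. [Mathlib `Turing.idComputableInPolyTime`] [folklore] -/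
theorem id_mem_FP : (id : List Bool → List Bool) ∈ FP :=
  PolyTimeComputable.id _

/-- States of the middle-block extractor. [folklore] -/
inductive MS
  | m0
  | m1
  | m2
  deriving DecidableEq, Fintype

/-- The middle-block extractor: on `hdr n a z = 1ⁿ 0 1ᵃ 0 z` emit `1ᵃ`. [folklore] -/
def midT : FST MS Bool Bool where
  init := MS.m0
  step := fun s c =>
    match s, c with
    | MS.m0, true => (MS.m0, [])
    | MS.m0, false => (MS.m1, [])
    | MS.m1, true => (MS.m1, [true])
    | MS.m1, false => (MS.m2, [])
    | MS.m2, _ => (MS.m2, [])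
  front := fun _ => []
  keep := fun _ => true

/-- `m2` discards. [folklore] -/
theorem midT_run_m2 (w : List Bool) : (midT.run MS.m2 w).2 = [] := by
  induction w with
  | nil => rfl
  | cons c w ih => rw [FST.run_cons, show midT.step MS.m2 c = (MS.m2, []) by cases c <;> rfl, ih]; rfl

/-- `m1` copies ones up to the terminator. [folklore] -/
theorem midT_run_m1 (a : ℕ) (z : List Bool) :
    (midT.run MS.m1 (List.replicate a true ++ false :: z)).2 = List.replicate a true := by
  induction a with
  | zero => rw [List.replicate_zero, List.nil_append, FST.run_cons,
      show midT.step MS.m1 false = (MS.m2, []) from rfl, midT_run_m2]; rfl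
  | succ a ih => rw [List.replicate_succ, List.cons_append, FST.run_cons,
      show midT.step MS.m1 true = (MS.m1, [true]) from rfl, ih]; rfl

/-- `m0` skips the first block. [folklore] -/
theorem midT_run_m0 (n a : ℕ) (z : List Bool) :
    (midT.run MS.m0 (hdr n a z)).2 = List.replicate a true := by
  unfold hdr
  induction n with
  | zero =>
    rw [show ones 0 = [] from rfl, List.nil_append, FST.run_cons,
      show midT.step MS.m0 false = (MS.m1, []) from rfl]
    exact midT_run_m1 a z
  | succ n ih =>
    rw [show ones (n + 1) = true :: ones n from rfl, List.cons_append, FST.run_cons,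
      show midT.step MS.m0 true = (MS.m0, []) from rfl, List.nil_append]
    exact ih

/-- `midT` on a header extracts the middle block. [folklore] -/
theorem midT_eval_hdr (n a : ℕ) (z : List Bool) : midT.eval (hdr n a z) = List.replicate a true := by
  simp only [FST.eval, show midT.init = MS.m0 from rfl, show ∀ s, midT.keep s = true from fun _ => rfl,
    show ∀ s, midT.front s = [] from fun _ => rfl, midT_run_m0, List.nil_append, if_true]

/-- **The unary pad** `padFn p z = 1^{p(|x|)}` for `x = (boolUnpair z).1`: the Horner clock
`evalHdrFn p` followed by the middle-block extractor. [Arora–Barak 2009, §1.3, §3.1] [folklore] -/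
noncomputable def padFn (p : Polynomial ℕ) : List Bool → List Bool :=
  midT.eval ∘ evalHdrFn p

/-- Semantics of the pad. [folklore] -/
theorem padFn_apply (p : Polynomial ℕ) (z : List Bool) :
    padFn p z = List.replicate (p.eval (boolUnpair z).1.length) true := by
  simp [padFn, evalHdrFn, midT_eval_hdr]

/-- **The unary pad is in `FP`.** [Arora–Barak 2009, §3.1] [folklore] -/
theorem padFn_mem_FP (p : Polynomial ℕ) : padFn p ∈ FP :=
  comp_mem_FP midT.polyTimeComputable_eval (evalHdrFn_mem_FP p)

/-! #### Recognising `listBool` codes of transcripts -/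

/-- The body of the `listBool` code of a transcript: iterated pairing. [H21 design C2] [folklore] -/
def body (t : List (List Bool)) : List Bool :=
  t.foldr (fun a acc => boolPair a acc) []

/-- `body [] = []`. [folklore] -/
@[simp] theorem body_nil : body [] = [] := rfl

/-- `body (a :: t) = boolPair a (body t)`. [folklore] -/
@[simp] theorem body_cons (a : List Bool) (t : List (List Bool)) : body (a :: t) = boolPair a (body t) := rfl

/-- The `listBool` code of a transcript, explicitly: `1^{2|t|} 0 1 body t`. [H21 design C2] [folklore] -/
theorem listBool_encode_eq (t : List (List Bool)) :
    (encodingList Bool).listBool.encode t = List.replicate (2 * t.length) true ++ false :: true :: body t := by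
  change boolPair (unaryEncodeNat t.length) (t.foldr (fun a acc => boolPair ((encodingList Bool).encode a) acc) []) = _
  rw [boolPair_unaryEncodeNat]
  rfl

/-- States of the code recogniser. [folklore] -/
inductive VS
  | h0
  | h1
  | x1
  | bs
  | bi
  | b1 (c : Bool)
  | rej
  deriving DecidableEq, Fintype

/-- **The code recogniser** `codeT`: it checks the shape `(11)* 01 ((00 ∣ 11)* 01)*` of a
`listBool` code and emits `boolPair 1ᵏ 1ᵐ` for `k` header pairs and `m` blocks (on a shape
failure it emits the non-member `boolPair ε 1` of `LenEq X` instead), so that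
`codeT.eval c ∈ LenEq X` iff `c` is the code of a transcript (`mem_codeLang_iff`).
[Hopcroft–Ullman 1979, §2.7] [folklore] -/
def codeT : FST VS Bool Bool where
  init := VS.h0
  step := fun s c =>
    match s, c with
    | VS.h0, true => (VS.h1, [])
    | VS.h0, false => (VS.x1, [])
    | VS.h1, true => (VS.h0, [true, true])
    | VS.h1, false => (VS.rej, [])
    | VS.x1, true => (VS.bs, [false, true])
    | VS.x1, false => (VS.rej, [])
    | VS.bs, c => (VS.b1 c, [])
    | VS.bi, c => (VS.b1 c, [])
    | VS.b1 d, c => if d = c then (VS.bi, []) else if c then (VS.bs, [true]) else (VS.rej, [])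
    | VS.rej, _ => (VS.rej, [])
  front := fun s => if s = VS.bs then [] else boolPair [] [true]
  keep := fun s => decide (s = VS.bs)

/-- Unary numerals are blocks of ones (the tree's namesake in `TautCertificates.lean` is not in this
file's import cone). [Mathlib `Computability.unaryEncodeNat`] [folklore] -/
theorem unaryEncodeNat_eq_replicate (k : ℕ) : unaryEncodeNat k = List.replicate k true := by
  induction k with
  | zero => rfl
  | succ k ih => rw [List.replicate_succ, ← ih]; rfl

/-- `boolPair 1ᵏ l = 1^{2k} 0 1 l`. [folklore] -/
theorem boolPair_replicate_eq (k : ℕ) (l : List Bool) :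
    boolPair (List.replicate k true) l = List.replicate (2 * k) true ++ false :: true :: l := by
  rw [← unaryEncodeNat_eq_replicate, boolPair_unaryEncodeNat]

/-- Transition from `b1 c` on the equal symbol. [folklore] -/
theorem codeT_step_b1_same (c : Bool) : codeT.step (VS.b1 c) c = (VS.bi, []) := by
  cases c <;> rfl

/-- `front` at the boundary state. [folklore] -/
theorem codeT_front_bs : codeT.front VS.bs = [] := rfl

/-- `front` off the boundary state. [folklore] -/
theorem codeT_front_ne {st : VS} (h : st ≠ VS.bs) : codeT.front st = boolPair [] [true] := by
  change (if st = VS.bs then [] else boolPair [] [true]) = _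
  rw [if_neg h]

/-- `keep` of the recogniser. [folklore] -/
theorem codeT_keep (st : VS) : codeT.keep st = decide (st = VS.bs) := rfl

/-- The verdict when the run ends at a boundary: the emitted count string. [folklore] -/
theorem codeT_eval_of_bs {c : List Bool} (h : (codeT.run VS.h0 c).1 = VS.bs) :
    codeT.eval c = (codeT.run VS.h0 c).2 := by
  simp only [FST.eval, show codeT.init = VS.h0 from rfl, h, codeT_front_bs, codeT_keep]
  simp

/-- The verdict when the run does not end at a boundary: the non-member `boolPair ε 1`. [folklore] -/
theorem codeT_eval_of_ne {c : List Bool} (h : (codeT.run VS.h0 c).1 ≠ VS.bs) :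
    codeT.eval c = boolPair [] [true] := by
  simp only [FST.eval, show codeT.init = VS.h0 from rfl, codeT_front_ne h, codeT_keep, decide_eq_true_eq,
    if_neg h, List.append_nil]

/-- `rej` is absorbing. [folklore] -/
theorem codeT_run_rej (w : List Bool) : (codeT.run VS.rej w).1 = VS.rej := by
  induction w with
  | nil => rfl
  | cons c w ih => rw [FST.run_cons, show codeT.step VS.rej c = (VS.rej, []) by cases c <;> rfl]; exact ih

/-- Header pairs. [folklore] -/
theorem codeT_run_h0_ones (k : ℕ) (l : List Bool) :
    codeT.run VS.h0 (List.replicate (2 * k) true ++ l) =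
      ((codeT.run VS.h0 l).1, List.replicate (2 * k) true ++ (codeT.run VS.h0 l).2) := by
  induction k with
  | zero => simp
  | succ k ih =>
    rw [show List.replicate (2 * (k + 1)) true ++ l = true :: true :: (List.replicate (2 * k) true ++ l) by
      rw [Nat.mul_succ]; rfl, FST.run_cons, show codeT.step VS.h0 true = (VS.h1, []) from rfl, FST.run_cons,
      show codeT.step VS.h1 true = (VS.h0, [true, true]) from rfl, ih]
    simp only [List.nil_append, Prod.mk.injEq, true_and]
    rw [show List.replicate (2 * (k + 1)) true = true :: true :: List.replicate (2 * k) true by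
      rw [Nat.mul_succ]; rfl]
    rfl

/-- The separator. [folklore] -/
theorem codeT_run_h0_sep (l : List Bool) :
    codeT.run VS.h0 (false :: true :: l) = ((codeT.run VS.bs l).1, false :: true :: (codeT.run VS.bs l).2) := by
  simp [FST.run_cons, show codeT.step VS.h0 false = (VS.x1, []) from rfl,
    show codeT.step VS.x1 true = (VS.bs, [false, true]) from rfl]

/-- One block, from a boundary or from inside. [folklore] -/
theorem codeT_run_block (a : List Bool) (l : List Bool) :
    ∀ st : VS, (st = VS.bs ∨ st = VS.bi) →
      codeT.run st ((a.flatMap fun b => [b, b]) ++ false :: true :: l) =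
        ((codeT.run VS.bs l).1, true :: (codeT.run VS.bs l).2) := by
  induction a with
  | nil =>
    intro st hst
    have h1 : codeT.step st false = (VS.b1 false, []) := by rcases hst with rfl | rfl <;> rfl
    simp [FST.run_cons, h1, show codeT.step (VS.b1 false) true = (VS.bs, [true]) from rfl]
  | cons c a ih =>
    intro st hst
    have h1 : codeT.step st c = (VS.b1 c, []) := by rcases hst with rfl | rfl <;> rfl
    rw [List.flatMap_cons, show [c, c] ++ List.flatMap (fun b => [b, b]) a ++ false :: true :: l =
      c :: c :: (List.flatMap (fun b => [b, b]) a ++ false :: true :: l) by simp, FST.run_cons, h1,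
      FST.run_cons, codeT_step_b1_same, ih VS.bi (Or.inr rfl)]
    simp

/-- A whole body. [folklore] -/
theorem codeT_run_body (t : List (List Bool)) (l : List Bool) :
    codeT.run VS.bs (body t ++ l) = ((codeT.run VS.bs l).1, List.replicate t.length true ++ (codeT.run VS.bs l).2) := by
  induction t with
  | nil => simp
  | cons a t ih =>
    rw [body_cons, show boolPair a (body t) ++ l = (a.flatMap fun b => [b, b]) ++ false :: true :: (body t ++ l)
      by simp [boolPair], codeT_run_block a _ VS.bs (Or.inl rfl), ih]
    simp [List.replicate_succ]

/-- **The recogniser on a genuine code** ends at a boundary and emits `boolPair 1^{|t|} 1^{|t|}`.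
[folklore] -/
theorem codeT_run_encode (t : List (List Bool)) :
    codeT.run VS.h0 ((encodingList Bool).listBool.encode t) =
      (VS.bs, boolPair (List.replicate t.length true) (List.replicate t.length true)) := by
  rw [listBool_encode_eq, codeT_run_h0_ones, codeT_run_h0_sep, ← List.append_nil (body t),
    codeT_run_body]
  simp [boolPair_replicate_eq]

/-- `codeT.eval` of a genuine code. [folklore] -/
theorem codeT_eval_encode (t : List (List Bool)) :
    codeT.eval ((encodingList Bool).listBool.encode t) =
      boolPair (List.replicate t.length true) (List.replicate t.length true) := by
  rw [codeT_eval_of_bs (by rw [codeT_run_encode]), codeT_run_encode]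

/-- **Inverting the header.** [folklore] -/
theorem codeT_header_inv : ∀ c : List Bool, (codeT.run VS.h0 c).1 = VS.bs →
    ∃ k rest, c = List.replicate (2 * k) true ++ false :: true :: rest ∧
      (codeT.run VS.bs rest).1 = VS.bs ∧
      (codeT.run VS.h0 c).2 = List.replicate (2 * k) true ++ false :: true :: (codeT.run VS.bs rest).2
  | [], h => by simp at h
  | [true], h => by simp [FST.run_cons, show codeT.step VS.h0 true = (VS.h1, []) from rfl] at h
  | true :: true :: c, h => by
    have e : codeT.run VS.h0 (true :: true :: c) = ((codeT.run VS.h0 c).1, true :: true :: (codeT.run VS.h0 c).2) := by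
      simp [FST.run_cons, show codeT.step VS.h0 true = (VS.h1, []) from rfl,
        show codeT.step VS.h1 true = (VS.h0, [true, true]) from rfl]
    rw [e] at h ⊢
    obtain ⟨k, rest, hc, hbs, hout⟩ := codeT_header_inv c h
    refine ⟨k + 1, rest, ?_, hbs, ?_⟩
    · rw [hc, Nat.mul_succ, List.replicate_add]; simp
    · simp only [hout, Nat.mul_succ, List.replicate_add]; simp
  | true :: false :: c, h => by
    have e : (codeT.run VS.h0 (true :: false :: c)).1 = VS.rej := by
      simp [FST.run_cons, show codeT.step VS.h0 true = (VS.h1, []) from rfl,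
        show codeT.step VS.h1 false = (VS.rej, []) from rfl, codeT_run_rej]
    rw [e] at h; cases h
  | [false], h => by simp [FST.run_cons, show codeT.step VS.h0 false = (VS.x1, []) from rfl] at h
  | false :: true :: rest, h => by
    refine ⟨0, rest, by simp, ?_, ?_⟩
    · rw [codeT_run_h0_sep] at h; exact h
    · rw [codeT_run_h0_sep]; simp
  | false :: false :: c, h => by
    have e : (codeT.run VS.h0 (false :: false :: c)).1 = VS.rej := by
      simp [FST.run_cons, show codeT.step VS.h0 false = (VS.x1, []) from rfl,
        show codeT.step VS.x1 false = (VS.rej, []) from rfl, codeT_run_rej]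
    rw [e] at h; cases h

/-- **Inverting the body**: a run from a boundary (resp. from inside a block) that ends at a
boundary has read a body (resp. the rest of a block followed by a body), emitting one `1` per
block end. [folklore] -/
theorem codeT_body_inv : ∀ (n : ℕ) (rest : List Bool), rest.length ≤ n →
    ((codeT.run VS.bs rest).1 = VS.bs → ∃ t : List (List Bool), rest = body t ∧
        (codeT.run VS.bs rest).2 = List.replicate t.length true) ∧
    ((codeT.run VS.bi rest).1 = VS.bs → ∃ (a : List Bool) (t : List (List Bool)),
        rest = (a.flatMap fun b => [b, b]) ++ false :: true :: body t ∧
        (codeT.run VS.bi rest).2 = List.replicate (t.length + 1) true)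
  | n, [], _ => ⟨fun _ => ⟨[], rfl, rfl⟩, fun h => by simp at h⟩
  | n, [c], _ => by
    constructor
    · intro h
      simp [FST.run_cons, show codeT.step VS.bs c = (VS.b1 c, []) from rfl] at h
    · intro h
      simp [FST.run_cons, show codeT.step VS.bi c = (VS.b1 c, []) from rfl] at h
  | 0, c :: c' :: rest, hn => by simp at hn
  | n + 1, c :: c' :: rest, hn => by
    have ih := codeT_body_inv n rest (by simp at hn; omega)
    -- the two runs agree after the first symbol
    have step_eq : ∀ st : VS, (st = VS.bs ∨ st = VS.bi) →
        codeT.run st (c :: c' :: rest) = codeT.run (VS.b1 c) (c' :: rest) := by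
      intro st hst
      have h1 : codeT.step st c = (VS.b1 c, []) := by rcases hst with rfl | rfl <;> rfl
      simp [FST.run_cons, h1]
    by_cases hcc : c = c'
    · subst hcc
      have e : codeT.run (VS.b1 c) (c :: rest) = ((codeT.run VS.bi rest).1, (codeT.run VS.bi rest).2) := by
        simp [FST.run_cons, codeT_step_b1_same]
      constructor
      · intro h
        rw [step_eq VS.bs (Or.inl rfl), e] at h ⊢
        obtain ⟨a, t, hrest, hout⟩ := ih.2 h
        refine ⟨(c :: a) :: t, ?_, ?_⟩
        · rw [hrest, body_cons]; simp [boolPair]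
        · simpa using hout
      · intro h
        rw [step_eq VS.bi (Or.inr rfl), e] at h ⊢
        obtain ⟨a, t, hrest, hout⟩ := ih.2 h
        refine ⟨c :: a, t, ?_, ?_⟩
        · rw [hrest]; simp
        · simpa using hout
    · cases c' with
      | false =>
        -- `c = true`, pair `10`: rejected
        have hc : c = true := by cases c <;> simp_all
        subst hc
        have e : (codeT.run (VS.b1 true) (false :: rest)).1 = VS.rej := by
          simp [FST.run_cons, show codeT.step (VS.b1 true) false = (VS.rej, []) from rfl, codeT_run_rej]
        constructor
        · intro h; rw [step_eq VS.bs (Or.inl rfl), e] at h; cases h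
        · intro h; rw [step_eq VS.bi (Or.inr rfl), e] at h; cases h
      | true =>
        have hc : c = false := by cases c <;> simp_all
        subst hc
        have e : codeT.run (VS.b1 false) (true :: rest) = ((codeT.run VS.bs rest).1, true :: (codeT.run VS.bs rest).2) := by
          simp [FST.run_cons, show codeT.step (VS.b1 false) true = (VS.bs, [true]) from rfl]
        constructor
        · intro h
          rw [step_eq VS.bs (Or.inl rfl), e] at h ⊢
          obtain ⟨t, hrest, hout⟩ := ih.1 h
          refine ⟨[] :: t, ?_, ?_⟩
          · rw [hrest, body_cons]; simp [boolPair]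
          · simp [hout, List.replicate_succ]
        · intro h
          rw [step_eq VS.bi (Or.inr rfl), e] at h ⊢
          obtain ⟨t, hrest, hout⟩ := ih.1 h
          refine ⟨[], t, ?_, ?_⟩
          · rw [hrest]; simp
          · simp [hout, List.replicate_succ]

/-- **The language of transcript codes** `{c | codeT.eval c ∈ LenEq X}`. [folklore] -/
def codeLang : Language Bool :=
  codeT.eval ⁻¹' LenEq X

/-- **`codeLang ∈ P`.** [Arora–Barak 2009, Def. 1.13] [folklore] -/
theorem codeLang_mem_P : codeLang ∈ Classes.P :=
  preimage_mem_P (LenEq_mem_P X) codeT.polyTimeComputable_eval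

/-- **`codeLang` is exactly the set of `listBool` codes of transcripts.** [H21 design C2] [folklore] -/
theorem mem_codeLang_iff (c : List Bool) :
    c ∈ codeLang ↔ ∃ t : List (List Bool), c = (encodingList Bool).listBool.encode t := by
  show codeT.eval c ∈ LenEq X ↔ _
  constructor
  · intro h
    -- the run must end at a boundary
    have hbs : (codeT.run VS.h0 c).1 = VS.bs := by
      by_contra hne
      rw [codeT_eval_of_ne hne, boolPair_mem_LenEq] at h
      simp at h
    obtain ⟨k, rest, hc, hrest, hout⟩ := codeT_header_inv c hbs
    obtain ⟨t, ht, hout'⟩ := (codeT_body_inv rest.length rest le_rfl).1 hrest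
    have heval : codeT.eval c = boolPair (List.replicate k true) (List.replicate t.length true) := by
      rw [codeT_eval_of_bs hbs, hout, hout', boolPair_replicate_eq]
    rw [heval, boolPair_mem_LenLe_eq] at h
    refine ⟨t, ?_⟩
    rw [hc, ht, listBool_encode_eq, ← h]
  · rintro ⟨t, rfl⟩
    rw [codeT_eval_encode, boolPair_mem_LenLe_eq]
where
  /-- Pairs of one-blocks in `LenEq X` have equal lengths. [folklore] -/
  boolPair_mem_LenLe_eq {k m : ℕ} :
      boolPair (List.replicate k true) (List.replicate m true) ∈ LenEq X ↔ m = k := by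
    rw [boolPair_mem_LenEq]
    simp

/-- **The sanitiser**: keep a genuine transcript code, replace anything else by the code of the
empty transcript (`StrCopy.sel` with the indicator of `codeLang`). [folklore] -/
noncomputable def sanFn : List Bool → List Bool :=
  (StrCopy.sel true ((encodingList Bool).listBool.encode ([] : List (List Bool)))).eval ∘
    pairFn (fun w => encodeBool (codeLang.boolIndicator w)) id

/-- The sanitiser fixes genuine codes. [folklore] -/
theorem sanFn_encode (t : List (List Bool)) :
    sanFn ((encodingList Bool).listBool.encode t) = (encodingList Bool).listBool.encode t := by
  have hmem : (encodingList Bool).listBool.encode t ∈ codeLang := (mem_codeLang_iff _).2 ⟨t, rfl⟩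
  unfold sanFn
  rw [Function.comp_apply, pairFn_apply, (Set.mem_iff_boolIndicator _ _).1 hmem]
  exact (StrCopy.sel_eval true true _ _).trans (by simp)

/-- The sanitiser always returns a genuine code. [folklore] -/
theorem exists_sanFn_eq (w : List Bool) : ∃ t : List (List Bool), sanFn w = (encodingList Bool).listBool.encode t := by
  unfold sanFn
  rw [Function.comp_apply, pairFn_apply]
  by_cases hw : w ∈ codeLang
  · obtain ⟨t, rfl⟩ := (mem_codeLang_iff w).1 hw
    rw [(Set.mem_iff_boolIndicator _ _).1 hw]
    exact ⟨t, (StrCopy.sel_eval true true _ _).trans (by simp)⟩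
  · rw [(Set.notMem_iff_boolIndicator _ _).1 hw]
    exact ⟨[], (StrCopy.sel_eval true false _ _).trans (by simp)⟩

/-- **The sanitiser is in `FP`.** [folklore] -/
theorem sanFn_mem_FP : sanFn ∈ FP :=
  comp_mem_FP (sel_mem_FP true _) (pairFn_mem_FP (indicatorFn_mem_FP codeLang_mem_P) id_mem_FP)

/-- A transcript decoder, right inverse of the code on the range of the sanitiser. [folklore] -/
noncomputable def decT (w : List Bool) : List (List Bool) :=
  Classical.choose (exists_sanFn_eq w)

/-- `sanFn w` is the code of `decT w`. [folklore] -/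
theorem sanFn_eq_encode_decT (w : List Bool) : sanFn w = (encodingList Bool).listBool.encode (decT w) :=
  Classical.choose_spec (exists_sanFn_eq w)

/-- On genuine codes the decoder decodes. [folklore] -/
theorem decT_encode (t : List (List Bool)) : decT ((encodingList Bool).listBool.encode t) = t := by
  have h := sanFn_eq_encode_decT ((encodingList Bool).listBool.encode t)
  rw [sanFn_encode] at h
  exact ((encodingList Bool).listBool.encode_injective h).symm

end Tools

/-! ### The string form of the small step -/

section StringStep

/-! #### State strings and their accessors

A state string is `⟨hdr, ⟨t1, ⟨restB, ph⟩⟩⟩` with `hdr = ⟨x, ⟨pad₁, pad₂⟩⟩` (`padᵢ = 1^{cᵢ}`),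
`restB = body rest` (iterated pairing, no length field), and the phase string `ph`:
`ε` (outer), `⟨0, ⟨y, code t2⟩⟩` (inner), `⟨1, code r⟩` (done). -/

/-- The phase string. [folklore] -/
def encPh : Phase → List Bool
  | Phase.outer => []
  | Phase.inner y t2 => boolPair [false] (boolPair y ((encodingList Bool).listBool.encode t2))
  | Phase.done r => boolPair [true] (stepCode r)

/-- The state string with header `hdr`. [folklore] -/
def encS (hdr : List Bool) (s : CState) : List Bool :=
  boolPair hdr (boolPair s.t1 (boolPair (body s.rest) (encPh s.ph)))

/-- The header `⟨x, ⟨1^{c₁}, 1^{c₂}⟩⟩`. [folklore] -/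
def hdrOf (x : List Bool) (c₁ c₂ : ℕ) : List Bool :=
  boolPair x (boolPair (List.replicate c₁ true) (List.replicate c₂ true))

/-- Accessor: the input `x`. [folklore] -/
def xA : List Bool → List Bool := fstP ∘ fstP
/-- Accessor: the first pad. [folklore] -/
def p1A : List Bool → List Bool := fstP ∘ sndP ∘ fstP
/-- Accessor: the second pad. [folklore] -/
def p2A : List Bool → List Bool := sndP ∘ sndP ∘ fstP
/-- Accessor: the outer answer bits. [folklore] -/
def t1A : List Bool → List Bool := fstP ∘ sndP
/-- Accessor: the remaining composite answers. [folklore] -/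
def restA : List Bool → List Bool := fstP ∘ sndP ∘ sndP
/-- Accessor: the phase string. [folklore] -/
def phA : List Bool → List Bool := sndP ∘ sndP ∘ sndP
/-- Accessor: the phase tag. [folklore] -/
def tagA : List Bool → List Bool := fstP ∘ phA
/-- Accessor: the phase payload. [folklore] -/
def plA : List Bool → List Bool := sndP ∘ phA
/-- Accessor: the outer query under simulation. [folklore] -/
def yA : List Bool → List Bool := fstP ∘ plA
/-- Accessor: the inner transcript code. [folklore] -/
def t2A : List Bool → List Bool := sndP ∘ plA

/-- `xA ∈ FP`. [folklore] -/
theorem xA_mem_FP : xA ∈ FP := comp_mem_FP fstP_mem_FP fstP_mem_FP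
/-- `p1A ∈ FP`. [folklore] -/
theorem p1A_mem_FP : p1A ∈ FP := comp_mem_FP fstP_mem_FP (comp_mem_FP sndP_mem_FP fstP_mem_FP)
/-- `p2A ∈ FP`. [folklore] -/
theorem p2A_mem_FP : p2A ∈ FP := comp_mem_FP sndP_mem_FP (comp_mem_FP sndP_mem_FP fstP_mem_FP)
/-- `t1A ∈ FP`. [folklore] -/
theorem t1A_mem_FP : t1A ∈ FP := comp_mem_FP fstP_mem_FP sndP_mem_FP
/-- `restA ∈ FP`. [folklore] -/
theorem restA_mem_FP : restA ∈ FP := comp_mem_FP fstP_mem_FP (comp_mem_FP sndP_mem_FP sndP_mem_FP)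
/-- `phA ∈ FP`. [folklore] -/
theorem phA_mem_FP : phA ∈ FP := comp_mem_FP sndP_mem_FP (comp_mem_FP sndP_mem_FP sndP_mem_FP)
/-- `tagA ∈ FP`. [folklore] -/
theorem tagA_mem_FP : tagA ∈ FP := comp_mem_FP fstP_mem_FP phA_mem_FP
/-- `plA ∈ FP`. [folklore] -/
theorem plA_mem_FP : plA ∈ FP := comp_mem_FP sndP_mem_FP phA_mem_FP
/-- `yA ∈ FP`. [folklore] -/
theorem yA_mem_FP : yA ∈ FP := comp_mem_FP fstP_mem_FP plA_mem_FP
/-- `t2A ∈ FP`. [folklore] -/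
theorem t2A_mem_FP : t2A ∈ FP := comp_mem_FP sndP_mem_FP plA_mem_FP

section AccessorValues

variable (hdr t1 restB ph : List Bool)

/-- Reading the state string. [folklore] -/
@[simp] theorem t1A_apply : t1A (boolPair hdr (boolPair t1 (boolPair restB ph))) = t1 := by simp [t1A]
/-- Reading the state string. [folklore] -/
@[simp] theorem restA_apply : restA (boolPair hdr (boolPair t1 (boolPair restB ph))) = restB := by
  simp [restA, fstP, sndP]
/-- Reading the state string. [folklore] -/
@[simp] theorem phA_apply : phA (boolPair hdr (boolPair t1 (boolPair restB ph))) = ph := by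
  simp [phA, sndP]
/-- Reading the state string. [folklore] -/
@[simp] theorem tagA_apply : tagA (boolPair hdr (boolPair t1 (boolPair restB ph))) = (boolUnpair ph).1 := by
  simp [tagA, fstP, sndP, phA]
/-- Reading the state string. [folklore] -/
@[simp] theorem plA_apply : plA (boolPair hdr (boolPair t1 (boolPair restB ph))) = (boolUnpair ph).2 := by
  simp [plA, sndP, phA]
/-- Reading the state string. [folklore] -/
@[simp] theorem yA_apply : yA (boolPair hdr (boolPair t1 (boolPair restB ph))) =
    (boolUnpair (boolUnpair ph).2).1 := by
  simp [yA, fstP, sndP, phA, plA]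
/-- Reading the state string. [folklore] -/
@[simp] theorem t2A_apply : t2A (boolPair hdr (boolPair t1 (boolPair restB ph))) =
    (boolUnpair (boolUnpair ph).2).2 := by
  simp [t2A, sndP, phA, plA]
/-- Reading the header. [folklore] -/
@[simp] theorem xA_apply (x : List Bool) (c₁ c₂ : ℕ) (w : List Bool) : xA (boolPair (hdrOf x c₁ c₂) w) = x := by
  simp [xA, hdrOf]
/-- Reading the header. [folklore] -/
@[simp] theorem p1A_apply (x : List Bool) (c₁ c₂ : ℕ) (w : List Bool) :
    p1A (boolPair (hdrOf x c₁ c₂) w) = List.replicate c₁ true := by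
  simp [p1A, hdrOf, fstP, sndP]
/-- Reading the header. [folklore] -/
@[simp] theorem p2A_apply (x : List Bool) (c₁ c₂ : ℕ) (w : List Bool) :
    p2A (boolPair (hdrOf x c₁ c₂) w) = List.replicate c₂ true := by
  simp [p2A, hdrOf, fstP, sndP]

end AccessorValues

/-! #### The pieces of the step -/

variable (M₁ M₂ : OracleAlg Bool)

/-- The code of the outer step on the current answer bits. [folklore] -/
noncomputable def c1Fn (v : List Bool) : List Bool :=
  stepCode (M₁.step (xA v) (bitsTrans (t1A v)))

/-- The code of the inner step on the (sanitised) current inner transcript. [folklore] -/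
noncomputable def d2Fn (v : List Bool) : List Bool :=
  stepCode (M₂.step (yA v) (decT (t2A v)))

/-- `c1Fn ∈ FP` for polynomial-time `M₁`. [folklore] -/
theorem c1Fn_mem_FP (hM₁ : M₁.IsPolyTime encodingBoolBool) : c1Fn M₁ ∈ FP :=
  stepCode_comp_mem_FP M₁ hM₁ xA_mem_FP t1A_mem_FP

/-- `d2Fn ∈ FP` for polynomial-time `M₂`: the machine of `M₂` is fed the genuine code
`boolPair y (sanFn (t2A v)) = ⟨y, code (decT (t2A v))⟩`. [Arora–Barak 2009, Thm. 2.8 (composition)] [folklore] -/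
theorem d2Fn_mem_FP (hM₂ : M₂.IsPolyTime encodingBoolBool) : d2Fn M₂ ∈ FP := by
  have hin : pairFn yA (sanFn ∘ t2A) ∈ FP := pairFn_mem_FP yA_mem_FP (comp_mem_FP sanFn_mem_FP t2A_mem_FP)
  have hG : PolyTimeComputable (id : List Bool → List Bool)
      (fun p : List Bool × List (List Bool) => boolPair p.1 ((encodingList Bool).listBool.encode p.2))
      (fun v => (yA v, decT (t2A v))) := by
    obtain ⟨p, Mx, h⟩ := hin
    refine ⟨p, Mx, fun v => ?_⟩
    have hv := h v
    simp only [id, pairFn_apply, Function.comp_apply, sanFn_eq_encode_decT] at hv ⊢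
    exact hv
  obtain ⟨p, Mx, h⟩ := PolyTimeComputable.comp_holds hM₂ hG
  exact ⟨p, Mx, fun v => h v⟩

/-- Truncation of `u` to the length of `pad`: `truncFn ⟨pad, u⟩ = u ↾ |pad|`. [folklore] -/
noncomputable def truncFn : List Bool → List Bool := sndP ∘ truncSndFn X

/-- Semantics of the truncation. [folklore] -/
@[simp] theorem truncFn_boolPair (pad u : List Bool) : truncFn (boolPair pad u) = u.take pad.length := by
  simp [truncFn, truncSndFn_boolPair]

/-- `truncFn ∈ FP`. [folklore] -/
theorem truncFn_mem_FP : truncFn ∈ FP := comp_mem_FP sndP_mem_FP (truncSndFn_mem_FP X)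

/-- The outer query, truncated by the first pad. [folklore] -/
noncomputable def y1Fn : List Bool → List Bool := truncFn ∘ pairFn p1A (List.tail ∘ c1Fn M₁)

/-- The inner query, truncated by the second pad. [folklore] -/
noncomputable def z2Fn : List Bool → List Bool := truncFn ∘ pairFn p2A (List.tail ∘ d2Fn M₂)

/-- `y1Fn ∈ FP`. [folklore] -/
theorem y1Fn_mem_FP (hM₁ : M₁.IsPolyTime encodingBoolBool) : y1Fn M₁ ∈ FP :=
  comp_mem_FP truncFn_mem_FP (pairFn_mem_FP p1A_mem_FP (comp_mem_FP tail_mem_FP (c1Fn_mem_FP M₁ hM₁)))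

/-- `z2Fn ∈ FP`. [folklore] -/
theorem z2Fn_mem_FP (hM₂ : M₂.IsPolyTime encodingBoolBool) : z2Fn M₂ ∈ FP :=
  comp_mem_FP truncFn_mem_FP (pairFn_mem_FP p2A_mem_FP (comp_mem_FP tail_mem_FP (d2Fn_mem_FP M₂ hM₂)))

/-- Appending an answer `a` to a transcript code `c`: `11 ++ c ++ ⟨a, ε⟩`. [H21 design C2] [folklore] -/
noncomputable def appFn : List Bool → List Bool :=
  (fun w => [true, true] ++ w) ∘ concatFn ∘ pairFn t2A (pairFn (fstP ∘ restA) (fun _ => []))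

/-- `appFn ∈ FP`. [folklore] -/
theorem appFn_mem_FP : appFn ∈ FP :=
  comp_mem_FP (prefix_mem_FP _) (comp_mem_FP concatFn_mem_FP
    (pairFn_mem_FP t2A_mem_FP (pairFn_mem_FP (comp_mem_FP fstP_mem_FP restA_mem_FP) (const_mem_FP _))))

/-- **Appending to a code is the code of the longer transcript.** [H21 design C2] [folklore] -/
theorem code_append (t2 : List (List Bool)) (a : List Bool) :
    [true, true] ++ ((encodingList Bool).listBool.encode t2 ++ boolPair a []) =
      (encodingList Bool).listBool.encode (t2 ++ [a]) := by
  rw [listBool_encode_eq, listBool_encode_eq, List.length_append, List.length_singleton]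
  have hb : body (t2 ++ [a]) = body t2 ++ boolPair a [] := by
    induction t2 with
    | nil => simp [body]
    | cons b t ih => simp [body, boolPair, List.append_assoc] at ih ⊢; rw [ih]
  rw [hb, show 2 * (t2.length + 1) = 2 * t2.length + 1 + 1 by ring, List.replicate_succ, List.replicate_succ]
  simp

/-! #### Guards (named, so that rewriting never meets an unfolded preimage) -/

/-- Guard: outer phase (`ph = ε`). [folklore] -/
def GOut : Language Bool := phA ⁻¹' IsNil
/-- Guard: inner phase (tag `0`). [folklore] -/
def GIn : Language Bool := tagA ⁻¹' HeadIs false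
/-- Guard: no composite answer left. [folklore] -/
def GNil : Language Bool := restA ⁻¹' IsNil
/-- Guard: the outer step is an output. [folklore] -/
noncomputable def GC1 : Language Bool := c1Fn M₁ ⁻¹' HeadIs true
/-- Guard: the inner step is an output. [folklore] -/
noncomputable def GD2 : Language Bool := d2Fn M₂ ⁻¹' HeadIs true

/-- Reading `GOut`. [folklore] -/
theorem mem_GOut {v : List Bool} : v ∈ GOut ↔ phA v = [] := Iff.rfl
/-- Reading `GIn`. [folklore] -/
theorem mem_GIn {v : List Bool} : v ∈ GIn ↔ (tagA v).head? = some false := Iff.rfl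
/-- Reading `GNil`. [folklore] -/
theorem mem_GNil {v : List Bool} : v ∈ GNil ↔ restA v = [] := Iff.rfl
/-- Reading `GC1`. [folklore] -/
theorem mem_GC1 {v : List Bool} : v ∈ GC1 M₁ ↔ (c1Fn M₁ v).head? = some true := Iff.rfl
/-- Reading `GD2`. [folklore] -/
theorem mem_GD2 {v : List Bool} : v ∈ GD2 M₂ ↔ (d2Fn M₂ v).head? = some true := Iff.rfl

/-- `GOut ∈ P`. [folklore] -/
theorem GOut_mem_P : GOut ∈ Classes.P := preimage_mem_P IsNil_mem_P phA_mem_FP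
/-- `GIn ∈ P`. [folklore] -/
theorem GIn_mem_P : GIn ∈ Classes.P := preimage_mem_P (HeadIs_mem_P false) tagA_mem_FP
/-- `GNil ∈ P`. [folklore] -/
theorem GNil_mem_P : GNil ∈ Classes.P := preimage_mem_P IsNil_mem_P restA_mem_FP
/-- `GC1 ∈ P` for polynomial-time `M₁`. [folklore] -/
theorem GC1_mem_P (hM₁ : M₁.IsPolyTime encodingBoolBool) : GC1 M₁ ∈ Classes.P :=
  preimage_mem_P (HeadIs_mem_P true) (c1Fn_mem_FP M₁ hM₁)
/-- `GD2 ∈ P` for polynomial-time `M₂`. [folklore] -/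
theorem GD2_mem_P (hM₂ : M₂.IsPolyTime encodingBoolBool) : GD2 M₂ ∈ Classes.P :=
  preimage_mem_P (HeadIs_mem_P true) (d2Fn_mem_FP M₂ hM₂)

/-! #### The branches and the step -/

/-- Outer phase, output `b`: `⟨t1, ⟨restB, ⟨1, 1 b⟩⟩⟩`. [folklore] -/
noncomputable def outDoneFn : List Bool → List Bool :=
  pairFn t1A (pairFn restA ((fun w => [true, true, false, true] ++ w) ∘ c1Fn M₁))
/-- Outer phase, query: `⟨t1, ⟨restB, ⟨0, ⟨y ↾ c₁, code ε⟩⟩⟩⟩`. [folklore] -/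
noncomputable def outQryFn : List Bool → List Bool :=
  pairFn t1A (pairFn restA ((fun w => [false, false, false, true] ++ w) ∘ pairFn (y1Fn M₁) (fun _ => [false, true])))
/-- Inner phase, output `b`: `⟨t1 b, ⟨restB, ε⟩⟩`. [folklore] -/
noncomputable def inDoneFn : List Bool → List Bool :=
  pairFn (concatFn ∘ pairFn t1A (List.tail ∘ d2Fn M₂)) (pairFn restA (fun _ => []))
/-- Inner phase, query, no answer left: `⟨t1, ⟨ε, ⟨1, 0 (z ↾ c₂)⟩⟩⟩`. [folklore] -/
noncomputable def inAskFn : List Bool → List Bool :=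
  pairFn t1A (pairFn (fun _ => []) ((fun w => [true, true, false, true, false] ++ w) ∘ z2Fn M₂))
/-- Inner phase, query, consume an answer: `⟨t1, ⟨restB', ⟨0, ⟨y, code (t2 a)⟩⟩⟩⟩`. [folklore] -/
noncomputable def inConsFn : List Bool → List Bool :=
  pairFn t1A (pairFn (sndP ∘ restA) ((fun w => [false, false, false, true] ++ w) ∘ pairFn yA appFn))

/-- The new `⟨t1, ⟨restB, ph⟩⟩` in the outer phase. [folklore] -/
noncomputable def outerFn : List Bool → List Bool :=
  condFn (GC1 M₁) (outDoneFn M₁) (outQryFn M₁)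

/-- The new `⟨t1, ⟨restB, ph⟩⟩` in the inner phase. [folklore] -/
noncomputable def innerFn : List Bool → List Bool :=
  condFn (GD2 M₂) (inDoneFn M₂) (condFn GNil (inAskFn M₂) (inConsFn))

/-- **The string form of the small step**: keep the header, rebuild the rest by phase.
[Ladner–Lynch–Selman 1975, §2; Arora–Barak 2009, §3.4] [folklore] -/
noncomputable def stepStr : List Bool → List Bool :=
  pairFn fstP (condFn GOut (outerFn M₁) (condFn GIn (innerFn M₂) sndP))

variable {M₁ M₂}

/-- `outerFn ∈ FP`. [folklore] -/
theorem outerFn_mem_FP (hM₁ : M₁.IsPolyTime encodingBoolBool) : outerFn M₁ ∈ FP :=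
  condFn_mem_FP (GC1_mem_P M₁ hM₁)
    (pairFn_mem_FP t1A_mem_FP (pairFn_mem_FP restA_mem_FP (comp_mem_FP (prefix_mem_FP _) (c1Fn_mem_FP M₁ hM₁))))
    (pairFn_mem_FP t1A_mem_FP (pairFn_mem_FP restA_mem_FP (comp_mem_FP (prefix_mem_FP _)
      (pairFn_mem_FP (y1Fn_mem_FP M₁ hM₁) (const_mem_FP _)))))

/-- `innerFn ∈ FP`. [folklore] -/
theorem innerFn_mem_FP (hM₂ : M₂.IsPolyTime encodingBoolBool) : innerFn M₂ ∈ FP :=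
  condFn_mem_FP (GD2_mem_P M₂ hM₂)
    (pairFn_mem_FP (comp_mem_FP concatFn_mem_FP (pairFn_mem_FP t1A_mem_FP (comp_mem_FP tail_mem_FP
      (d2Fn_mem_FP M₂ hM₂)))) (pairFn_mem_FP restA_mem_FP (const_mem_FP _)))
    (condFn_mem_FP GNil_mem_P
      (pairFn_mem_FP t1A_mem_FP (pairFn_mem_FP (const_mem_FP _) (comp_mem_FP (prefix_mem_FP _) (z2Fn_mem_FP M₂ hM₂))))
      (pairFn_mem_FP t1A_mem_FP (pairFn_mem_FP (comp_mem_FP sndP_mem_FP restA_mem_FP)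
        (comp_mem_FP (prefix_mem_FP _) (pairFn_mem_FP yA_mem_FP appFn_mem_FP)))))

/-- **The string step is in `FP`.** [Arora–Barak 2009, Thm. 2.8 (composition)] [folklore] -/
theorem stepStr_mem_FP (hM₁ : M₁.IsPolyTime encodingBoolBool) (hM₂ : M₂.IsPolyTime encodingBoolBool) :
    stepStr M₁ M₂ ∈ FP :=
  pairFn_mem_FP fstP_mem_FP (condFn_mem_FP GOut_mem_P (outerFn_mem_FP hM₁)
    (condFn_mem_FP GIn_mem_P (innerFn_mem_FP hM₂) sndP_mem_FP))

/-! #### Values of the branches -/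

variable (M₁ M₂)
variable (v : List Bool)

/-- Value of `outDoneFn`. [folklore] -/
theorem outDoneFn_apply : outDoneFn M₁ v =
    boolPair (t1A v) (boolPair (restA v) ([true, true, false, true] ++ c1Fn M₁ v)) := by
  simp [outDoneFn]

/-- Value of `outQryFn`. [folklore] -/
theorem outQryFn_apply : outQryFn M₁ v =
    boolPair (t1A v) (boolPair (restA v) ([false, false, false, true] ++ boolPair (y1Fn M₁ v) [false, true])) := by
  simp [outQryFn]

/-- Value of `inDoneFn`. [folklore] -/
theorem inDoneFn_apply : inDoneFn M₂ v = boolPair (t1A v ++ (d2Fn M₂ v).tail) (boolPair (restA v) []) := by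
  simp [inDoneFn]

/-- Value of `inAskFn`. [folklore] -/
theorem inAskFn_apply : inAskFn M₂ v =
    boolPair (t1A v) (boolPair [] ([true, true, false, true, false] ++ z2Fn M₂ v)) := by
  simp [inAskFn]

/-- Value of `inConsFn`. [folklore] -/
theorem inConsFn_apply : inConsFn v =
    boolPair (t1A v) (boolPair (sndP (restA v)) ([false, false, false, true] ++ boolPair (yA v) (appFn v))) := by
  simp [inConsFn]

/-- Value of `appFn`. [folklore] -/
theorem appFn_apply : appFn v = [true, true] ++ (t2A v ++ boolPair (fstP (restA v)) []) := by
  simp [appFn]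

/-- Value of `y1Fn`. [folklore] -/
theorem y1Fn_apply : y1Fn M₁ v = (c1Fn M₁ v).tail.take (p1A v).length := by
  simp [y1Fn]

/-- Value of `z2Fn`. [folklore] -/
theorem z2Fn_apply : z2Fn M₂ v = (d2Fn M₂ v).tail.take (p2A v).length := by
  simp [z2Fn]

/-- **Value of the string step** on an arbitrary string, by cases on the guards. [folklore] -/
theorem stepStr_apply : stepStr M₁ M₂ v = boolPair (fstP v)
    (if phA v = [] then (if (c1Fn M₁ v).head? = some true then outDoneFn M₁ v else outQryFn M₁ v)
     else if (tagA v).head? = some false then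
       (if (d2Fn M₂ v).head? = some true then inDoneFn M₂ v
        else if restA v = [] then inAskFn M₂ v else inConsFn v)
     else sndP v) := by
  unfold stepStr outerFn innerFn
  rw [pairFn_apply]
  congr 1
  by_cases h1 : phA v = []
  · rw [condFn_of_mem _ _ (mem_GOut.2 h1), if_pos h1]
    by_cases h2 : (c1Fn M₁ v).head? = some true
    · rw [condFn_of_mem _ _ ((mem_GC1 M₁).2 h2), if_pos h2]
    · rw [condFn_of_not_mem _ _ (fun h => h2 ((mem_GC1 M₁).1 h)), if_neg h2]
  · rw [condFn_of_not_mem _ _ (fun h => h1 (mem_GOut.1 h)), if_neg h1]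
    by_cases h3 : (tagA v).head? = some false
    · rw [condFn_of_mem _ _ (mem_GIn.2 h3), if_pos h3]
      by_cases h4 : (d2Fn M₂ v).head? = some true
      · rw [condFn_of_mem _ _ ((mem_GD2 M₂).2 h4), if_pos h4]
      · rw [condFn_of_not_mem _ _ (fun h => h4 ((mem_GD2 M₂).1 h)), if_neg h4]
        by_cases h5 : restA v = []
        · rw [condFn_of_mem _ _ (mem_GNil.2 h5), if_pos h5]
        · rw [condFn_of_not_mem _ _ (fun h => h5 (mem_GNil.1 h)), if_neg h5]
    · rw [condFn_of_not_mem _ _ (fun h => h3 (mem_GIn.1 h)), if_neg h3]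

/-- The header is preserved exactly. [folklore] -/
theorem fstP_stepStr : fstP (stepStr M₁ M₂ v) = fstP v := by
  unfold stepStr
  rw [pairFn_apply, fstP_boolPair]

/-! #### The string step simulates the small step on state strings -/

variable {M₁ M₂}

/-- `boolPair [b] w = b b 0 1 w`. [folklore] -/
theorem boolPair_singleton (b : Bool) (w : List Bool) : boolPair [b] w = [b, b, false, true] ++ w := by
  simp [boolPair]

/-- A pair is never empty (the tree's namesake `QCircuit.boolPair_ne_nil` lives in a quantum-circuit
file that must not be imported here). [folklore] -/
theorem boolPair_ne_nil (a w : List Bool) : boolPair a w ≠ [] := by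
  cases a <;> simp [boolPair]

/-- **Simulation**: on the string of a state the string step produces the string of the next
state (header `⟨x, ⟨1^{c₁}, 1^{c₂}⟩⟩`). [Ladner–Lynch–Selman 1975, §2] [folklore] -/
theorem stepStr_encS (x : List Bool) (c₁ c₂ : ℕ) (st : CState) :
    stepStr M₁ M₂ (encS (hdrOf x c₁ c₂) st) = encS (hdrOf x c₁ c₂) (F M₁ M₂ x c₁ c₂ st) := by
  obtain ⟨t1, rest, ph⟩ := st
  rw [stepStr_apply]
  unfold encS
  rw [fstP_boolPair]
  congr 1
  have hc1 : ∀ phs : List Bool, c1Fn M₁ (boolPair (hdrOf x c₁ c₂) (boolPair t1 (boolPair (body rest) phs))) =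
      stepCode (M₁.step x (bitsTrans t1)) := fun phs => by
    simp [c1Fn]
  simp only [restA_apply, phA_apply, tagA_apply]
  cases ph with
  | outer =>
    simp only [encPh, if_true]
    cases hs : M₁.step x (bitsTrans t1) with
    | inr b =>
      rw [hc1, hs, stepCode_inr, if_pos (by simp), outDoneFn_apply, F_outer_output hs]
      simp [hc1, hs, boolPair_singleton]
    | inl y =>
      rw [hc1, hs, stepCode_inl, if_neg (by simp), outQryFn_apply, F_outer_query hs]
      simp [y1Fn_apply, hc1, hs, boolPair_singleton, listBool_encode_nil]
  | inner y t2 =>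
    simp only [encPh]
    have hd2 : d2Fn M₂ (boolPair (hdrOf x c₁ c₂) (boolPair t1 (boolPair (body rest)
        (boolPair [false] (boolPair y ((encodingList Bool).listBool.encode t2)))))) = stepCode (M₂.step y t2) := by
      simp [d2Fn, decT_encode]
    rw [if_neg (boolPair_ne_nil _ _), if_pos (by simp)]
    cases hs : M₂.step y t2 with
    | inr b =>
      rw [hd2, hs, stepCode_inr, if_pos (by simp), inDoneFn_apply, F_inner_output hs]
      simp [hd2, hs]
    | inl z =>
      rw [hd2, hs, stepCode_inl, if_neg (by simp)]
      cases rest with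
      | nil =>
        rw [if_pos (by simp), inAskFn_apply, F_inner_query_nil hs, z2Fn_apply, hd2, hs, stepCode_inl]
        simp [boolPair_singleton]
      | cons a rest' =>
        rw [if_neg (by simp [boolPair_ne_nil]), inConsFn_apply, F_inner_query_cons hs]
        simp only [t1A_apply, restA_apply, yA_apply, t2A_apply, boolUnpair_boolPair, appFn_apply, body_cons,
          fstP_boolPair, sndP_boolPair, code_append]
        simp [boolPair_singleton]
  | done r =>
    simp only [encPh]
    rw [if_neg (boolPair_ne_nil _ _), if_neg (by simp), F_done, sndP_boolPair]

/-- Iterated simulation. [folklore] -/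
theorem iterate_stepStr_encS (x : List Bool) (c₁ c₂ : ℕ) (n : ℕ) (st : CState) :
    (stepStr M₁ M₂)^[n] (encS (hdrOf x c₁ c₂) st) = encS (hdrOf x c₁ c₂) ((F M₁ M₂ x c₁ c₂)^[n] st) := by
  induction n generalizing st with
  | zero => rfl
  | succ n ih => rw [Function.iterate_succ_apply, Function.iterate_succ_apply, stepStr_encS, ih]

end StringStep

/-! ### Linear growth of the string step -/

section Growth

variable (M₁ M₂ : OracleAlg Bool)

/-- The part of a state string not charged to the potential: twice the outer query in the inner
phase, the payload in the done phase, nothing in the outer phase. [folklore] -/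
def slack (v : List Bool) : ℕ :=
  if phA v = [] then 0 else if (tagA v).head? = some false then 2 * (yA v).length else (plA v).length

/-- The pad allowance `2|pad₁| + |pad₂| + 2` (a function of the header only). [folklore] -/
def allow (v : List Bool) : ℕ :=
  2 * (p1A v).length + (p2A v).length + 2

/-- A step code starting with `1` is `1 b`. [folklore] -/
theorem length_stepCode_of_head (r : List Bool ⊕ Bool) (h : (stepCode r).head? = some true) :
    (stepCode r).length = 2 := by
  cases r with
  | inl y => simp at h
  | inr b => rfl

/-- A step code never is empty. [folklore] -/
theorem one_le_length_stepCode (r : List Bool ⊕ Bool) : 1 ≤ (stepCode r).length := by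
  cases r <;> simp

variable {M₁ M₂}

/-- Parse bounds of a state string (all total). [folklore] -/
theorem parse_bounds (v : List Bool) :
    2 * (fstP v).length + 2 * (t1A v).length + 2 * (restA v).length + (phA v).length ≤ v.length ∧
    2 * (tagA v).length + (plA v).length ≤ (phA v).length ∧
    2 * (yA v).length + (t2A v).length ≤ (plA v).length ∧
    2 * (fstP (restA v)).length + (sndP (restA v)).length ≤ (restA v).length ∧
    (p1A v).length ≤ (fstP v).length ∧ (p2A v).length ≤ (fstP v).length := by
  have h0 := length_boolUnpair_le v
  have h1 := length_boolUnpair_le (boolUnpair v).2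
  have h2 := length_boolUnpair_le (boolUnpair (boolUnpair v).2).2
  have h3 := length_boolUnpair_le (phA v)
  have h4 := length_boolUnpair_le (plA v)
  have h5 := length_boolUnpair_le (restA v)
  have h6 := length_boolUnpair_le (fstP v)
  have h7 := length_boolUnpair_le (boolUnpair (fstP v)).2
  simp only [fstP, sndP, t1A, restA, phA, tagA, plA, yA, t2A, p1A, p2A, Function.comp_apply] at *
  omega

/-- **One step of potential**: `|stepStr v| + slack v ≤ |v| + slack (stepStr v) + 18`, for every
string `v`. [folklore] -/
theorem length_stepStr_le (v : List Bool) :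
    (stepStr M₁ M₂ v).length + slack v ≤ v.length + slack (stepStr M₁ M₂ v) + 18 ∧
    slack (stepStr M₁ M₂ v) ≤ max (slack v) (allow v) := by
  obtain ⟨hb0, hb1, hb2, hb3, hb4, hb5⟩ := parse_bounds v
  rw [stepStr_apply]
  by_cases h1 : phA v = []
  · have hsl : slack v = 0 := by simp [slack, h1]
    rw [if_pos h1, hsl]
    by_cases h2 : (c1Fn M₁ v).head? = some true
    · -- outer, output
      rw [if_pos h2, outDoneFn_apply, ← boolPair_singleton]
      have hc : (c1Fn M₁ v).length = 2 := length_stepCode_of_head _ h2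
      simp only [slack, allow, phA_apply, tagA_apply, plA_apply, boolUnpair_boolPair, length_boolPair,
        List.length_singleton, boolPair_ne_nil, if_false]
      simp only [List.head?_cons, Option.some.injEq, Bool.true_eq_false, if_false, hc]
      omega
    · -- outer, query
      rw [if_neg h2, outQryFn_apply, ← boolPair_singleton]
      have hy : (y1Fn M₁ v).length ≤ (p1A v).length := by
        rw [y1Fn_apply, List.length_take]; exact min_le_left _ _
      simp only [slack, allow, phA_apply, tagA_apply, yA_apply, boolUnpair_boolPair, length_boolPair,
        List.length_cons, List.length_nil, boolPair_ne_nil, if_false, List.head?_cons, if_true]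
      omega
  · rw [if_neg h1]
    by_cases h3 : (tagA v).head? = some false
    · have hsl : slack v = 2 * (yA v).length := by simp [slack, h1, h3]
      rw [if_pos h3, hsl]
      by_cases h4 : (d2Fn M₂ v).head? = some true
      · -- inner, output
        rw [if_pos h4, inDoneFn_apply]
        have hd : (d2Fn M₂ v).length = 2 := length_stepCode_of_head _ h4
        simp only [slack, allow, phA_apply, length_boolPair, List.length_append, List.length_tail, hd,
          List.length_nil, if_true]
        omega
      · rw [if_neg h4]
        by_cases h5 : restA v = []
        · -- inner, query, ask
          rw [if_pos h5, inAskFn_apply, show [true, true, false, true, false] ++ z2Fn M₂ v =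
            boolPair [true] (false :: z2Fn M₂ v) by simp [boolPair]]
          have hz : (z2Fn M₂ v).length ≤ (p2A v).length := by
            rw [z2Fn_apply, List.length_take]; exact min_le_left _ _
          simp only [slack, allow, phA_apply, tagA_apply, plA_apply, boolUnpair_boolPair, length_boolPair,
            List.length_cons, List.length_nil, boolPair_ne_nil, if_false, List.head?_cons,
            Option.some.injEq, Bool.true_eq_false]
          omega
        · -- inner, query, consume
          rw [if_neg h5, inConsFn_apply, ← boolPair_singleton]
          simp only [slack, allow, phA_apply, tagA_apply, yA_apply, boolUnpair_boolPair, length_boolPair,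
            boolPair_ne_nil, if_false, List.head?_cons, if_true, appFn_apply,
            List.length_append, List.length_cons, List.length_nil]
          omega
    · -- done (or junk): copy
      have hsl : slack v = (plA v).length := by simp [slack, h1, h3]
      rw [if_neg h3, hsl]
      have hs' : slack (boolPair (fstP v) (sndP v)) = (plA v).length := by
        have e1 : phA (boolPair (fstP v) (sndP v)) = phA v := by simp [phA, sndP]
        have e2 : tagA (boolPair (fstP v) (sndP v)) = tagA v := by simp [tagA, phA, sndP]
        have e3 : plA (boolPair (fstP v) (sndP v)) = plA v := by simp [plA, phA, sndP]
        simp [slack, e1, e2, e3, h1, h3]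
      rw [hs']
      have := length_rePair_le v
      simp only [fstP, sndP] at this ⊢
      constructor
      · omega
      · exact le_max_left _ _

/-- The pads are preserved. [folklore] -/
theorem allow_stepStr (v : List Bool) : allow (stepStr M₁ M₂ v) = allow v := by
  simp only [allow, p1A, p2A, Function.comp_apply, fstP_stepStr]

/-- **Linear growth of the iterated string step**: `|stepStr^[n] v| ≤ 20 (|v| + n)`.
[Arora–Barak 2009, §1.4.1 (the clocked universal machine needs linear-size configurations)] [folklore] -/
theorem length_iterate_stepStr_le (v : List Bool) (n : ℕ) :
    ((stepStr M₁ M₂)^[n] v).length ≤ 20 * (v.length + n) := by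
  -- telescoping the potential
  have key : ∀ n, ((stepStr M₁ M₂)^[n] v).length + slack v ≤ v.length + slack ((stepStr M₁ M₂)^[n] v) + 18 * n ∧
      slack ((stepStr M₁ M₂)^[n] v) ≤ max (slack v) (allow v) := by
    intro n
    induction n with
    | zero => simp
    | succ n ih =>
      rw [Function.iterate_succ_apply']
      obtain ⟨h1, h2⟩ := length_stepStr_le (M₁ := M₁) (M₂ := M₂) ((stepStr M₁ M₂)^[n] v)
      have hal : allow ((stepStr M₁ M₂)^[n] v) = allow v := by
        clear h1 h2 ih
        induction n with
        | zero => rfl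
        | succ n ih' => rw [Function.iterate_succ_apply', allow_stepStr, ih']
      rw [hal] at h2
      constructor
      · omega
      · exact h2.trans (max_le (ih.2) (le_max_right _ _))
  obtain ⟨h1, h2⟩ := key n
  obtain ⟨hb0, hb1, hb2, -, hb4, hb5⟩ := parse_bounds v
  have hsv : slack v ≤ v.length := by
    unfold slack; split_ifs <;> omega
  have hav : allow v ≤ 2 * v.length + 2 := by unfold allow; omega
  have hsn : slack ((stepStr M₁ M₂)^[n] v) ≤ 2 * v.length + 2 :=
    h2.trans (max_le (by omega) hav)
  rcases Nat.eq_zero_or_pos n with rfl | hn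
  · simp only [Function.iterate_zero, id_eq, add_zero]; omega
  · omega

end Growth

/-! ### The composite step function is polynomial-time -/

section Machine

variable (M₁ M₂ : OracleAlg Bool) (q₁ q₂ : Polynomial ℕ)

/-! #### Initial state and clock -/

/-- The initial state string `⟨⟨x, ⟨1^{q₁|x|}, 1^{q₂(q₁|x|)}⟩⟩, ⟨ε, ⟨body ans, ε⟩⟩⟩` read off the
input `⟨x, code ans⟩`. [folklore] -/
noncomputable def initS : List Bool → List Bool :=
  pairFn (pairFn fstP (pairFn (padFn q₁) (padFn q₂ ∘ pairFn (padFn q₁) (fun _ => []))))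
    (pairFn (fun _ => []) (pairFn (sndP ∘ sndP) (fun _ => [])))

/-- `initS ∈ FP`. [folklore] -/
theorem initS_mem_FP : initS q₁ q₂ ∈ FP :=
  pairFn_mem_FP (pairFn_mem_FP fstP_mem_FP (pairFn_mem_FP (padFn_mem_FP q₁)
    (comp_mem_FP (padFn_mem_FP q₂) (pairFn_mem_FP (padFn_mem_FP q₁) (const_mem_FP _)))))
    (pairFn_mem_FP (const_mem_FP _) (pairFn_mem_FP (comp_mem_FP sndP_mem_FP sndP_mem_FP) (const_mem_FP _)))

/-- The `listBool` code is `⟨1^{|ans|}, body ans⟩`. [H21 design C2] [folklore] -/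
theorem code_eq_boolPair (ans : List (List Bool)) :
    (encodingList Bool).listBool.encode ans = boolPair (List.replicate ans.length true) (body ans) := by
  rw [← unaryEncodeNat_eq_replicate]
  rfl

/-- **The initial state string is the string of the initial state.** [folklore] -/
theorem initS_apply (x : List Bool) (ans : List (List Bool)) :
    initS q₁ q₂ (boolPair x ((encodingList Bool).listBool.encode ans)) =
      encS (hdrOf x (q₁.eval x.length) (q₂.eval (q₁.eval x.length))) ⟨[], ans, Phase.outer⟩ := by
  simp [initS, code_eq_boolPair, padFn_apply, encS, hdrOf, encPh]

/-- The unary clock `1^{|ans| + 2 q₁|x| + 2}` read off the input. [folklore] -/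
noncomputable def clockS : List Bool → List Bool :=
  concatFn ∘ pairFn (fstP ∘ sndP) (concatFn ∘ pairFn (padFn q₁) (concatFn ∘ pairFn (padFn q₁) (fun _ => [true, true])))

/-- `clockS ∈ FP`. [folklore] -/
theorem clockS_mem_FP : clockS q₁ ∈ FP :=
  comp_mem_FP concatFn_mem_FP (pairFn_mem_FP (comp_mem_FP fstP_mem_FP sndP_mem_FP)
    (comp_mem_FP concatFn_mem_FP (pairFn_mem_FP (padFn_mem_FP q₁)
      (comp_mem_FP concatFn_mem_FP (pairFn_mem_FP (padFn_mem_FP q₁) (const_mem_FP _))))))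

/-- **The clock has the length of the fuel.** [folklore] -/
theorem clockS_apply (x : List Bool) (ans : List (List Bool)) :
    clockS q₁ (boolPair x ((encodingList Bool).listBool.encode ans)) =
      List.replicate (fuel q₁ x ans.length) true := by
  simp only [clockS, Function.comp_apply, pairFn_apply, concatFn_boolPair, code_eq_boolPair, fstP_boolPair,
    sndP_boolPair, padFn_apply, boolUnpair_boolPair, fuel]
  rw [show ans.length + 2 * q₁.eval x.length + 2 = ans.length + (q₁.eval x.length + (q₁.eval x.length + 2)) by ring,
    List.replicate_add, List.replicate_add, List.replicate_add]
  rfl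

/-- States of the clock/state combiner. [folklore] -/
inductive OS
  | ev0
  | ev1 (b : Bool)
  | tl
  deriving DecidableEq, Fintype

/-- The combiner: on `boolPair u s` emit `none^{|u|}` then `s` with `some` (the input format of
`PolyTimeComputable.iterate`). [folklore] -/
def optT : FST OS Bool (Option Bool) where
  init := OS.ev0
  step := fun st c =>
    match st with
    | OS.ev0 => (OS.ev1 c, [])
    | OS.ev1 b => if b = c then (OS.ev0, [none]) else (OS.tl, [])
    | OS.tl => (OS.tl, [some c])
  front := fun _ => []
  keep := fun _ => true

/-- In the tail the combiner tags with `some`. [folklore] -/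
theorem optT_run_tl (s : List Bool) : optT.run OS.tl s = (OS.tl, s.map some) := by
  induction s with
  | nil => rfl
  | cons c s ih => rw [FST.run_cons, show optT.step OS.tl c = (OS.tl, [some c]) from rfl, ih]; rfl

/-- On a doubled prefix the combiner emits one `none` per pair. [folklore] -/
theorem optT_run_ev0_dup (u : List Bool) (l : List Bool) :
    optT.run OS.ev0 ((u.flatMap fun b => [b, b]) ++ l) =
      ((optT.run OS.ev0 l).1, List.replicate u.length none ++ (optT.run OS.ev0 l).2) := by
  induction u with
  | nil => simp
  | cons b u ih =>
    simp only [List.flatMap_cons, List.cons_append, List.nil_append, FST.run_cons]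
    rw [show optT.step OS.ev0 b = (OS.ev1 b, []) from rfl]
    simp only [show optT.step (OS.ev1 b) b = (OS.ev0, [none]) by simp [optT]]
    rw [ih]
    simp [List.replicate_succ]

/-- **The combiner on `boolPair u s`.** [folklore] -/
theorem optT_eval_boolPair (u s : List Bool) :
    optT.eval (boolPair u s) = List.replicate u.length none ++ s.map some := by
  have hsep : optT.run OS.ev0 (false :: true :: s) = (OS.tl, s.map some) := by
    rw [FST.run_cons, show optT.step OS.ev0 false = (OS.ev1 false, []) from rfl]
    simp only [FST.run_cons, show optT.step (OS.ev1 false) true = (OS.tl, []) by simp [optT], optT_run_tl]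
    simp
  have hrun := optT_run_ev0_dup u (false :: true :: s)
  rw [hsep] at hrun
  have hb : boolPair u s = (u.flatMap fun b => [b, b]) ++ (false :: true :: s) := by simp [boolPair]
  simp only [FST.eval, show optT.init = OS.ev0 from rfl, show ∀ st, optT.keep st = true from fun _ => rfl,
    show ∀ st, optT.front st = [] from fun _ => rfl, hb, hrun]
  simp

/-- The input of the clocked iteration: clock in unary `none`s, then the initial state string.
[Arora–Barak 2009, §1.4.1] [folklore] -/
noncomputable def iterIn (w : List Bool) : List (Option Bool) :=
  optT.eval (pairFn (clockS q₁) (initS q₁ q₂) w)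

/-- `iterIn` is polynomial-time (string to `Option Bool`-string). [folklore] -/
theorem polyTimeComputable_iterIn :
    PolyTimeComputable (id : List Bool → List Bool) (id : List (Option Bool) → List (Option Bool)) (iterIn q₁ q₂) :=
  PolyTimeComputable.comp_holds optT.polyTimeComputable_eval (pairFn_mem_FP (clockS_mem_FP q₁) (initS_mem_FP q₁ q₂))

/-- Value of `iterIn` on every string: the clock length and the initial state string. [folklore] -/
theorem iterIn_eq (w : List Bool) :
    iterIn q₁ q₂ w = List.replicate (clockS q₁ w).length none ++ (initS q₁ q₂ w).map some := by
  simp [iterIn, optT_eval_boolPair]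

/-! #### The clocked iteration and the final read-out -/

/-- The state string after the clocked iteration. [folklore] -/
noncomputable def iterS (w : List Bool) : List Bool :=
  (stepStr M₁ M₂)^[(clockS q₁ w).length] (initS q₁ q₂ w)

variable {M₁ M₂}

/-- **The clocked iteration is in `FP`** (`PolyTimeComputable.iterate` with the linear growth
bound, after `iterIn`). [Arora–Barak 2009, §1.4.1] [folklore] -/
theorem iterS_mem_FP (hM₁ : M₁.IsPolyTime encodingBoolBool) (hM₂ : M₂.IsPolyTime encodingBoolBool) :
    iterS M₁ M₂ q₁ q₂ ∈ FP := by
  have hit := PolyTimeComputable.iterate (α := List Bool) (A := Bool) (ea := id) (F := stepStr M₁ M₂) 20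
    (fun a n => length_iterate_stepStr_le a n) (stepStr_mem_FP hM₁ hM₂)
  have hg : PolyTimeComputable (id : List Bool → List Bool)
      (fun q : List Bool × ℕ => List.replicate q.2 none ++ (id q.1).map some)
      (fun w => (initS q₁ q₂ w, (clockS q₁ w).length)) := by
    obtain ⟨p, Mx, h⟩ := polyTimeComputable_iterIn q₁ q₂
    refine ⟨p, Mx, fun w => ?_⟩
    have hw := h w
    rw [id, iterIn_eq] at hw
    exact hw
  obtain ⟨p, Mx, h⟩ := PolyTimeComputable.comp_holds hit hg
  exact ⟨p, Mx, fun w => h w⟩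

/-- Value of the clocked iteration on a genuine input. [folklore] -/
theorem iterS_apply (x : List Bool) (ans : List (List Bool)) :
    iterS M₁ M₂ q₁ q₂ (boolPair x ((encodingList Bool).listBool.encode ans)) =
      encS (hdrOf x (q₁.eval x.length) (q₂.eval (q₁.eval x.length)))
        ((F M₁ M₂ x (q₁.eval x.length) (q₂.eval (q₁.eval x.length)))^[fuel q₁ x ans.length] ⟨[], ans, Phase.outer⟩) := by
  rw [iterS, clockS_apply, List.length_replicate, initS_apply, iterate_stepStr_encS]

/-- Guard: the simulation has finished (tag `1`). [folklore] -/
def GDone : Language Bool := tagA ⁻¹' HeadIs true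

/-- Reading `GDone`. [folklore] -/
theorem mem_GDone {v : List Bool} : v ∈ GDone ↔ (tagA v).head? = some true := Iff.rfl

/-- `GDone ∈ P`. [folklore] -/
theorem GDone_mem_P : GDone ∈ Classes.P := preimage_mem_P (HeadIs_mem_P true) tagA_mem_FP

/-- The read-out: the payload of a finished simulation, the junk code `1 0` otherwise. [folklore] -/
noncomputable def readFn : List Bool → List Bool :=
  condFn GDone plA (fun _ => [true, false])

/-- `readFn ∈ FP`. [folklore] -/
theorem readFn_mem_FP : readFn ∈ FP := condFn_mem_FP GDone_mem_P plA_mem_FP (const_mem_FP _)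

/-- **The read-out of a state string is the code of its result.** [folklore] -/
theorem readFn_encS (hdr : List Bool) (st : CState) : readFn (encS hdr st) = stepCode (result st) := by
  obtain ⟨t1, rest, ph⟩ := st
  unfold readFn encS
  cases ph with
  | outer =>
    rw [condFn_of_not_mem _ _ (fun h => by have := mem_GDone.1 h; simp [encPh] at this)]
    rfl
  | inner y t2 =>
    rw [condFn_of_not_mem _ _ (fun h => by have := mem_GDone.1 h; simp [encPh] at this)]
    rfl
  | done r =>
    rw [condFn_of_mem _ _ (mem_GDone.2 (by simp [encPh]))]
    simp [encPh, result]

/-- The composite step function as a string map. [folklore] -/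
noncomputable def compStr : List Bool → List Bool :=
  readFn ∘ iterS M₁ M₂ q₁ q₂

/-- `compStr ∈ FP`. [folklore] -/
theorem compStr_mem_FP (hM₁ : M₁.IsPolyTime encodingBoolBool) (hM₂ : M₂.IsPolyTime encodingBoolBool) :
    compStr (M₁ := M₁) (M₂ := M₂) q₁ q₂ ∈ FP :=
  comp_mem_FP readFn_mem_FP (iterS_mem_FP q₁ q₂ hM₁ hM₂)

/-- **The string map computes the composite step function.** [folklore] -/
theorem compStr_apply (x : List Bool) (ans : List (List Bool)) :
    compStr (M₁ := M₁) (M₂ := M₂) q₁ q₂ (boolPair x ((encodingList Bool).listBool.encode ans)) =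
      stepCode ((compAlg M₁ M₂ q₁ q₂).step x ans) := by
  rw [compStr, Function.comp_apply, iterS_apply, readFn_encS, compAlg_step]

/-- **The composite oracle algorithm is polynomial-time.** [Ladner–Lynch–Selman 1975, §2;
Arora–Barak 2009, §3.4 and Thm. 2.8 (composition)] [folklore] -/
theorem isPolyTime_compAlg (hM₁ : M₁.IsPolyTime encodingBoolBool) (hM₂ : M₂.IsPolyTime encodingBoolBool) :
    (compAlg M₁ M₂ q₁ q₂).IsPolyTime encodingBoolBool := by
  obtain ⟨p, Mx, h⟩ := compStr_mem_FP q₁ q₂ hM₁ hM₂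
  refine ⟨p, Mx, fun q => ?_⟩
  have hq := h (boolPair q.1 ((encodingList Bool).listBool.encode q.2))
  rw [id, compStr_apply] at hq
  exact hq

end Machine

end OracleCompose

/-! ### Discharges -/

open OracleCompose in
/-- **`P^O` is closed downwards under Cook reductions** (`P^{P^O} = P^O`): the discharge of the
named fact `mem_PRel_of_polyTimeTuringReducible` (`Oracle.lean`). Given `L ∈ P^A` by `M₁` and
`A ∈ P^O` by `M₂`, the composite oracle algorithm `compAlg M₁ M₂` answers each query of `M₁` by
running `M₂` with oracle `O`; it decides `L` within the budget `q₁ · (q₂ ∘ q₁) + q₂ ∘ q₁ + 1`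
(`compAlg_correct`) and its step function is polynomial-time (`isPolyTime_compAlg`).
(Ladner–Lynch–Selman 1975, §2: transitivity of `≤ᵀᴾ`, "the proof is routine".)
[cite: LadnerLynchSelman1975, §2] -/
theorem mem_PRel_of_polyTimeTuringReducible_holds : mem_PRel_of_polyTimeTuringReducible := by
  intro O L A hLA hA
  obtain ⟨M₁, hM₁, q₁, hq₁⟩ := hLA
  obtain ⟨M₂, hM₂, q₂, hq₂⟩ := hA
  exact ⟨compAlg M₁ M₂ q₁ q₂, isPolyTime_compAlg q₁ q₂ hM₁ hM₂, budget q₁ q₂, compAlg_correct hq₁ hq₂⟩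

/-- **Polynomial-time Turing reducibility is transitive**: the discharge of the named fact
`polyTimeTuringReducible_trans` (`Oracle.lean`). [cite: LadnerLynchSelman1975, §2] -/
theorem polyTimeTuringReducible_trans_holds : polyTimeTuringReducible_trans :=
  fun h₁₂ h₂₃ => mem_PRel_of_polyTimeTuringReducible_holds h₁₂ h₂₃

/-- **`P^{P^C} ⊆ P^C`** for every class `C` of language oracles — the unconditional `CplxCore`
form of `Literature.Computability.QuantumComplexity.PRelClass_PRelClass_subset` (`IQPPostselection.lean:296`, which takes
`hcomp : mem_PRel_of_polyTimeTuringReducible`; see the module's `refactor:` note).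
(Bremner–Jozsa–Shepherd 2011, §3.1: "for any complexity class `C` we have `P^{(P^C)} = P^C`";
Ladner–Lynch–Selman 1975, §2.) [cite: BremnerJozsaShepherdPRSA2011, §3.1] [cite: LadnerLynchSelman1975, §2] -/
theorem PRelClass_PRelClass_subset_self (C : Set (Language Bool)) : PRelClass (PRelClass C) ⊆ PRelClass C := by
  intro L hL
  obtain ⟨A, hA, hLA⟩ := mem_PRelClass_iff.1 hL
  obtain ⟨B, hB, hAB⟩ := mem_PRelClass_iff.1 hA
  exact mem_PRelClass_iff.2 ⟨B, hB, mem_PRel_of_polyTimeTuringReducible_holds hLA hAB⟩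

end Literature.Computability.Complexity
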